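import Literature.Computability.QuantumComplexity.AaronsonAmbainisThm23SemanticsCons
import Literature.Computability.QuantumComplexity.AaronsonAmbainisThm23Reduction
import Literature.Computability.Complexity.FoldBricks
import Literature.Computability.Complexity.IterateFPPoly
import Literature.Computability.Complexity.AdaptiveQueries
import HarnessLib

/-!
# Aaronson–Ambainis 2014, Thm. 23 — the machine half: the polynomial-time simulation under `P = P^{#P}`

The last machine-level file of the polynomial-time half of [AA14, Thm. 23] (arXiv:0911.0996v3,
p. 14: "we can implement `C` using not only `poly(n)` queries to `A`, but also `poly(n)`
computation steps … the problem of computing `E[p_j]`, `Vr[p_j]`, `Inf_i[p_j]` is in `P^{#P}` …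
under `P = P^{#P}` the entire counting hierarchy collapses to `P`"). On top of the counting
formulas (`AaronsonAmbainisThm23Formulas.lean`) and their meaning
(`AaronsonAmbainisThm23Semantics.lean`, `AaronsonAmbainisThm23SemanticsCons.lean`) it proves
**`thm23_dyadicMachines`**, the machine hypothesis `hmach` of
`aaronsonAmbainis2014_thm23_apx_of_dyadicMachines` (`AaronsonAmbainisThm23Reduction.lean`) and of
`Barriers.QuantumAdvantage.randomOracleMethod_of_dyadicMachines`: for all `c k`, under
`P = P^{#P}`, every uniform Clifford+T query family `F` has a polynomial-time deterministic
oracle machine with `poly(n)` queries of `poly(n)` length whose verdict on `(A, x)` is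
`[(simTreeOn c 2^{-k} F x).eval (oracleBits F x A) ≥ 1/2]`. In five parts:

1. **The sums** (`readList`, `mathTerm`, `gSummand_rec`, `sumS_encW`, `sumS_quad_sub`,
   `sumS_pair_sub`): the nested exponential sums `sumS κ ±` of the formulas file, on a coded node,
   are the path-tuple sums `quadSum`/`2^{2μ}·pairSum` of `AaronsonAmbainisMoments.lean`.
2. **The tests** (`ZPair`, `Pst`, `pst_iff`, `test_mem_CH`, `outL`/`varL`/`infL` with `_mem_CH`
   and `mem_outL_iff`/`mem_varL_iff`/`mem_infL_iff`): the exact `√2`-sign tests `E[p_ρ] ≥ 1/2`,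
   `Vr[p_ρ] ≤ 1/(400n³)`, `1/(2^k (400 n³ d)^c) ≤ Inf_i[p_ρ]` are counting-hierarchy predicates
   (Torán's calculus, `CHFormulas.lean`).
3. **The generator and the evaluator** (`widthW`, `bigM`, `lenRho`, `budgetD`, `Halt`, `InfAt`,
   `IsPick`, `Live`, `PickBitL`, all in `CH`; under the collapse `pickBitsFn`, `strOfFn`,
   `mkWFn`, `genRound`, `genIter`, **`genQ ∈ FP`**, **`evalD ∈ P`**): the walk of
   `AaronsonAmbainisSimTreeWalk.lean` in the transcript model `AdQuery.adAlg`.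
4. **Their meaning** (`theta0`/`wthr0`/`budget0` = the parameters of `simTreeOn`, `theta0_eq`,
   `wthr0_eq`, `budget0_eq`; `live_iff`, `isPick_iff`, `bitsToNat_pickBitsFn`, `genRound_state`,
   `genIter_apply`, **`genQ_apply`**, **`mem_evalD_iff`**): the replay is `walkR`, the query is
   the string of `nextVar`, the verdict is `[E[p_ρ] ≥ 1/2]`.
5. **The machine** (`roundPoly`, `answers_adBits`, `thm23_machine`, **`thm23_dyadicMachines`**):
   `adAlg genQ q₀ evalD` with `q₀ ≥ ⌈8d/(wδ)⌉`, correct by `simTree_output_eq_of_answers`.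

No named facts.

## References

* S. Aaronson, A. Ambainis, *The need for structure in quantum speedups*, Theory Comput. 10
  (2014) 133–166, Thm. 21, Cor. 22, Thm. 23 and its proof (arXiv:0911.0996v3, p. 14)
  [AaronsonAmbainis2014].
* J. Torán, *Complexity classes defined by counting quantifiers*, J. ACM 38 (1991), §4.
* S. Arora, B. Barak, *Computational Complexity: A Modern Approach*, CUP 2009, §3.4, §17.2.1.
-/

noncomputable section

namespace Literature.Computability.QuantumComplexity

namespace Thm23Machine

open _root_.Computability Polynomial Complexity Complexity.Brick Complexity.Plumb Cryptography ADH Finset OracleReads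
open Complexity.PRelSigma Complexity.TTClosure Complexity.PPSharpP Complexity.ThresholdPP ClassicalSimulation
open Literature.Computability.Complexity.AdQuery
open scoped Classical

attribute [-simp] Brick.nthF_zero Brick.sndPow_zero

/-! ## Part 1 — the sums on a coded node -/

section Sums

variable (F : QCircuitFamily cliffordT) (x : List Bool)
variable (ρ : List (Fin (numOracleBits F x) × Bool)) (i : Fin (numOracleBits F x))

/-! ### The mathematical summand -/

/-- **The read list of kind `κ`** at a quadruple of coin functions: the reads of slots `0, 1`
(unflipped), followed for a quadruple kind by those of slots `2, 3` (flipped iff `κ.fl`) — the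
argument of `consWt` in `pairSum`/`quadSum`. [folklore] -/
def readList (κ : Kind) (c : Fin 4 → (Fin (gts F x).length → Bool)) : List (Fin (numOracleBits F x) × Bool × Bool) :=
  if κ.quad then (rd F x (c 0) false ++ rd F x (c 1) false) ++ (rd F x (c 2) κ.fl ++ rd F x (c 3) κ.fl)
  else rd F x (c 0) false ++ rd F x (c 1) false

/-- **The mathematical summand** of kind `κ` and sign `pos` at a quadruple of coin functions:
`2^{K − |freeIdx|}` if the term is `±1` and the reads are consistent, else `0`. [cite: AaronsonAmbainis2014, proof of Thm. 23 (p. 14)] -/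
def mathTerm (κ : Kind) (pos : Bool) (c : Fin 4 → (Fin (gts F x).length → Bool)) : ℕ :=
  if termVal F x κ c = (if pos then 1 else -1) ∧ Cons ρ i (readList F x κ c)
  then 2 ^ (κ.kfac * (gts F x).length - (freeIdx ρ (readList F x κ c)).card) else 0

/-- The slots of a kind are among `0, 1, 2, 3` and without repetition. [folklore] -/
theorem Kind.slots_lt_four (κ : Kind) : (∀ s ∈ κ.slots, s < 4) ∧ κ.slots.Nodup := by
  unfold Kind.slots; split_ifs <;> exact ⟨by decide, by decide⟩

/-- The flip tags of the four slots. [folklore] -/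
theorem flS_vals (fl : Bool) : flS fl 0 = false ∧ flS fl 1 = false ∧ flS fl 2 = fl ∧ flS fl 3 = fl := by
  unfold flS; cases fl <;> decide

/-- The read list carries the slots of the kind. [folklore] -/
theorem carries_readList (κ : Kind) (v : ℕ → ℕ) :
    Carries F x κ.fl κ.slots v (readList F x κ fun s => digits (gts F x).length (v s)) := by
  obtain ⟨f0, f1, f2, f3⟩ := flS_vals κ.fl
  intro r
  unfold readList Kind.slots
  obtain ⟨q, bX, bY, fl⟩ := κ
  simp only at f0 f1 f2 f3 ⊢
  cases q
  · simp only [Bool.false_eq_true, ↓reduceIte, List.mem_append, List.mem_cons, List.not_mem_nil, or_false]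
    constructor
    · rintro (h | h)
      · exact ⟨0, Or.inl rfl, by rw [f0]; exact h⟩
      · exact ⟨1, Or.inr rfl, by rw [f1]; exact h⟩
    · rintro ⟨s, rfl | rfl, h⟩
      · left; rw [f0] at h; exact h
      · right; rw [f1] at h; exact h
  · simp only [↓reduceIte, List.mem_append, List.mem_cons, List.not_mem_nil, or_false]
    constructor
    · rintro ((h | h) | (h | h))
      · exact ⟨0, Or.inl rfl, by rw [f0]; exact h⟩
      · exact ⟨1, Or.inr (Or.inl rfl), by rw [f1]; exact h⟩
      · exact ⟨2, Or.inr (Or.inr (Or.inl rfl)), by rw [f2]; exact h⟩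
      · exact ⟨3, Or.inr (Or.inr (Or.inr rfl)), by rw [f3]; exact h⟩
    · rintro ⟨s, rfl | rfl | rfl | rfl, h⟩
      · left; left; rw [f0] at h; exact h
      · left; right; rw [f1] at h; exact h
      · right; left; rw [f2] at h; exact h
      · right; right; rw [f3] at h; exact h

/-! ### The summand on a record -/

variable {R : List Bool} (hx : xR R = x) (hd : dR R = F.descFn x) (hρ : rhoR R = encRho ρ) (hi : iR R = encodeNat i)
variable {v : ℕ → ℕ} (hc : ∀ s < 4, coinR s R = encodeNat (v s))
include hx hd hρ hi hc

/-- **The summand on a record with coin numerals**: zero off the guard, the mathematical summand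
of the digit functions on it. [cite: AaronsonAmbainis2014, proof of Thm. 23 (p. 14)] -/
theorem gSummand_rec (κ : Kind) (pos : Bool) :
    gSummand F κ pos R = if ∀ s < 4, v s < 2 ^ (gts F x).length
      then mathTerm F x ρ i κ pos (fun s => digits (gts F x).length (v s)) else 0 := by
  obtain ⟨hσ, hnd⟩ := Kind.slots_lt_four κ
  have hL := carries_readList F x κ v
  unfold gSummand mathTerm
  rw [guard_iff F x hx hd hc, tSign_iff F x hx hc κ pos, consAll_iff F x ρ i hx hd hρ hi hc hσ hL,
    nGates_eq F x hx hd, freeCnt_eq F x ρ hx hd hρ hc hσ hnd hL]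
  by_cases hg : ∀ s < 4, v s < 2 ^ (gts F x).length
  · rw [if_pos hg]
    by_cases h2 : termVal F x κ (fun s => digits (gts F x).length (v s)) = (if pos then 1 else -1) ∧
        Cons ρ i (readList F x κ fun s => digits (gts F x).length (v s))
    · rw [if_pos ⟨hg, h2⟩, if_pos h2]
    · rw [if_neg (fun h => h2 h.2), if_neg h2]
  · rw [if_neg hg, if_neg (fun h => hg h.1)]

end Sums

/-! ### The nested sums on a coded node -/

section Nested

variable (F : QCircuitFamily cliffordT) (x : List Bool)
variable (ρ : List (Fin (numOracleBits F x) × Bool)) (i : Fin (numOracleBits F x))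

/-- Truncating a range sum whose terms vanish from `2^μ` on. [folklore] -/
theorem sum_range_trunc {μ N : ℕ} (hN : 2 ^ μ ≤ N) {f : ℕ → ℕ} (hf : ∀ v, 2 ^ μ ≤ v → f v = 0) :
    ∑ v ∈ range N, f v = ∑ v ∈ range (2 ^ μ), f v := by
  symm
  refine Finset.sum_subset (fun v hv => Finset.mem_range.2 ((Finset.mem_range.1 hv).trans_le hN)) fun v _ hv => hf v ?_
  rw [Finset.mem_range, not_lt] at hv; exact hv

/-- The summand on the record of the coded node with coin numerals `v₀ v₁ v₂ v₃`. [folklore] -/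
theorem gSummand_recV (κ : Kind) (pos : Bool) (v₀ v₁ v₂ v₃ : ℕ) :
    gSummand F κ pos (recV F x ρ i v₀ v₁ v₂ v₃) =
      if v₀ < 2 ^ (gts F x).length ∧ v₁ < 2 ^ (gts F x).length ∧ v₂ < 2 ^ (gts F x).length ∧ v₃ < 2 ^ (gts F x).length
      then mathTerm F x ρ i κ pos (fun s => digits (gts F x).length (![v₀, v₁, v₂, v₃] s)) else 0 := by
  obtain ⟨hx, hd, hρ, hi, h0, h1, h2, h3⟩ := access_recV F x ρ i v₀ v₁ v₂ v₃
  let v : ℕ → ℕ := fun s => if s = 0 then v₀ else if s = 1 then v₁ else if s = 2 then v₂ else v₃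
  have hv : ∀ s < 4, coinR s (recV F x ρ i v₀ v₁ v₂ v₃) = encodeNat (v s) := fun s hs => by
    interval_cases s
    · exact h0
    · exact h1
    · exact h2
    · exact h3
  rw [gSummand_rec F x ρ i hx hd hρ hi hv κ pos]
  have hfun : (fun s : Fin 4 => digits (gts F x).length (v s)) = fun s => digits (gts F x).length (![v₀, v₁, v₂, v₃] s) := by
    funext s; fin_cases s <;> rfl
  rw [hfun]
  have hiff : (∀ s < 4, v s < 2 ^ (gts F x).length) ↔
      (v₀ < 2 ^ (gts F x).length ∧ v₁ < 2 ^ (gts F x).length ∧ v₂ < 2 ^ (gts F x).length ∧ v₃ < 2 ^ (gts F x).length) := by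
    constructor
    · intro h; exact ⟨h 0 (by norm_num), h 1 (by norm_num), h 2 (by norm_num), h 3 (by norm_num)⟩
    · rintro ⟨a, b, c, d⟩ s hs
      interval_cases s
      · exact a
      · exact b
      · exact c
      · exact d
  by_cases hg : ∀ s < 4, v s < 2 ^ (gts F x).length
  · rw [if_pos hg, if_pos (hiff.1 hg)]
  · rw [if_neg hg, if_neg (fun h => hg (hiff.2 h))]

/-- `μ ≤ |encW F x ρ i|` (the description is a field). [folklore] -/
theorem mu_le_length_encW : (gts F x).length ≤ (encW F x ρ i).length := by
  have h1 := length_gates_le_length_descFn F x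
  change (F.circ x.length).gates.length ≤ _
  unfold encW
  simp only [length_boolPair]
  omega

/-- **The nested sums on a coded node are the sums of the mathematical summand over quadruples
of coin functions.** [cite: AaronsonAmbainis2014, proof of Thm. 23 (p. 14)] -/
theorem sumS_encW (κ : Kind) (pos : Bool) :
    sumS F κ pos (encW F x ρ i) =
      ∑ c₀ : Fin (gts F x).length → Bool, ∑ c₁ : Fin (gts F x).length → Bool,
        ∑ c₂ : Fin (gts F x).length → Bool, ∑ c₃ : Fin (gts F x).length → Bool, mathTerm F x ρ i κ pos ![c₀, c₁, c₂, c₃] := by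
  set μ := (gts F x).length with hμ
  set W := encW F x ρ i with hW
  have hWμ : μ ≤ W.length := mu_le_length_encW F x ρ i
  -- the guarded summand as a function of the four numerals
  set T : ℕ → ℕ → ℕ → ℕ → ℕ := fun v₀ v₁ v₂ v₃ =>
    if v₀ < 2 ^ μ ∧ v₁ < 2 ^ μ ∧ v₂ < 2 ^ μ ∧ v₃ < 2 ^ μ
    then mathTerm F x ρ i κ pos (fun s => digits μ (![v₀, v₁, v₂, v₃] s)) else 0 with hT
  have hTg : ∀ v₀ v₁ v₂ v₃, gSummand F κ pos (boolPair (boolPair (boolPair (boolPair W (encodeNat v₀)) (encodeNat v₁)) (encodeNat v₂))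
      (encodeNat v₃)) = T v₀ v₁ v₂ v₃ := fun v₀ v₁ v₂ v₃ => gSummand_recV F x ρ i κ pos v₀ v₁ v₂ v₃
  -- unfold the four nested range sums
  have hunfold : sumS F κ pos W = ∑ v₀ ∈ range (2 ^ W.length),
      ∑ v₁ ∈ range (2 ^ (boolPair W (encodeNat v₀)).length),
        ∑ v₂ ∈ range (2 ^ (boolPair (boolPair W (encodeNat v₀)) (encodeNat v₁)).length),
          ∑ v₃ ∈ range (2 ^ (boolPair (boolPair (boolPair W (encodeNat v₀)) (encodeNat v₁)) (encodeNat v₂)).length),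
            T v₀ v₁ v₂ v₃ := by
    simp only [sumS, sumS1, sumS2, sumS3, eval_X, hTg]
  rw [hunfold]
  -- truncate every range to `2^μ`
  have hlen : ∀ (w : List Bool) (v : ℕ), μ ≤ w.length → μ ≤ (boolPair w (encodeNat v)).length := fun w v h => by
    rw [length_boolPair]; omega
  have hpow : ∀ {n : ℕ}, μ ≤ n → 2 ^ μ ≤ 2 ^ n := fun h => Nat.pow_le_pow_right (by norm_num) h
  have h3 : ∀ v₀ v₁ v₂ (w : List Bool), μ ≤ w.length →
      ∑ v₃ ∈ range (2 ^ w.length), T v₀ v₁ v₂ v₃ = ∑ v₃ ∈ range (2 ^ μ), T v₀ v₁ v₂ v₃ := fun v₀ v₁ v₂ w hw =>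
    sum_range_trunc (hpow hw) fun v hv => by simp only [hT]; rw [if_neg]; intro h; exact absurd h.2.2.2 (not_lt.2 hv)
  have h2 : ∀ v₀ v₁ (w : List Bool), μ ≤ w.length →
      ∑ v₂ ∈ range (2 ^ w.length), ∑ v₃ ∈ range (2 ^ (boolPair w (encodeNat v₂)).length), T v₀ v₁ v₂ v₃ =
        ∑ v₂ ∈ range (2 ^ μ), ∑ v₃ ∈ range (2 ^ μ), T v₀ v₁ v₂ v₃ := fun v₀ v₁ w hw => by
    rw [Finset.sum_congr rfl fun v₂ _ => h3 v₀ v₁ v₂ _ (hlen w v₂ hw)]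
    refine sum_range_trunc (hpow hw) fun v hv => Finset.sum_eq_zero fun v₃ _ => ?_
    simp only [hT]; rw [if_neg]; intro h; exact absurd h.2.2.1 (not_lt.2 hv)
  have h1 : ∀ v₀ (w : List Bool), μ ≤ w.length →
      ∑ v₁ ∈ range (2 ^ w.length), ∑ v₂ ∈ range (2 ^ (boolPair w (encodeNat v₁)).length),
          ∑ v₃ ∈ range (2 ^ (boolPair (boolPair w (encodeNat v₁)) (encodeNat v₂)).length), T v₀ v₁ v₂ v₃ =
        ∑ v₁ ∈ range (2 ^ μ), ∑ v₂ ∈ range (2 ^ μ), ∑ v₃ ∈ range (2 ^ μ), T v₀ v₁ v₂ v₃ := fun v₀ w hw => by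
    rw [Finset.sum_congr rfl fun v₁ _ => h2 v₀ v₁ _ (hlen w v₁ hw)]
    refine sum_range_trunc (hpow hw) fun v hv => Finset.sum_eq_zero fun v₂ _ => Finset.sum_eq_zero fun v₃ _ => ?_
    simp only [hT]; rw [if_neg]; intro h; exact absurd h.2.1 (not_lt.2 hv)
  rw [Finset.sum_congr rfl fun v₀ _ => h1 v₀ _ (hlen W v₀ hWμ)]
  rw [sum_range_trunc (hpow hWμ) fun v hv => Finset.sum_eq_zero fun v₁ _ => Finset.sum_eq_zero fun v₂ _ =>
    Finset.sum_eq_zero fun v₃ _ => by simp only [hT]; rw [if_neg]; intro h; exact absurd h.1 (not_lt.2 hv)]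
  -- inside the truncated ranges the guard holds: the summand is the mathematical term of the digits
  have hin : ∀ v₀ ∈ range (2 ^ μ), ∀ v₁ ∈ range (2 ^ μ), ∀ v₂ ∈ range (2 ^ μ), ∀ v₃ ∈ range (2 ^ μ),
      T v₀ v₁ v₂ v₃ = mathTerm F x ρ i κ pos ![digits μ v₀, digits μ v₁, digits μ v₂, digits μ v₃] := by
    intro v₀ h₀ v₁ h₁ v₂ h₂ v₃ h₃
    rw [Finset.mem_range] at h₀ h₁ h₂ h₃
    simp only [hT, h₀, h₁, h₂, h₃, and_self, if_true]
    congr 1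
    funext s
    fin_cases s <;> rfl
  rw [Finset.sum_congr rfl fun v₀ h₀ => Finset.sum_congr rfl fun v₁ h₁ => Finset.sum_congr rfl fun v₂ h₂ =>
    Finset.sum_congr rfl fun v₃ h₃ => hin v₀ h₀ v₁ h₁ v₂ h₂ v₃ h₃]
  -- reindex by coin functions, innermost first
  simp_rw [show ∀ v₀ v₁ v₂, (∑ v₃ ∈ range (2 ^ μ), mathTerm F x ρ i κ pos ![digits μ v₀, digits μ v₁, digits μ v₂, digits μ v₃]) =
      ∑ c₃ : Fin μ → Bool, mathTerm F x ρ i κ pos ![digits μ v₀, digits μ v₁, digits μ v₂, c₃] from fun v₀ v₁ v₂ =>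
    sum_range_two_pow_eq_sum_fn μ (fun c₃ => mathTerm F x ρ i κ pos ![digits μ v₀, digits μ v₁, digits μ v₂, c₃])]
  simp_rw [show ∀ v₀ v₁, (∑ v₂ ∈ range (2 ^ μ), ∑ c₃ : Fin μ → Bool, mathTerm F x ρ i κ pos ![digits μ v₀, digits μ v₁, digits μ v₂, c₃]) =
      ∑ c₂ : Fin μ → Bool, ∑ c₃ : Fin μ → Bool, mathTerm F x ρ i κ pos ![digits μ v₀, digits μ v₁, c₂, c₃] from fun v₀ v₁ =>
    sum_range_two_pow_eq_sum_fn μ (fun c₂ => ∑ c₃ : Fin μ → Bool, mathTerm F x ρ i κ pos ![digits μ v₀, digits μ v₁, c₂, c₃])]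
  simp_rw [show ∀ v₀, (∑ v₁ ∈ range (2 ^ μ), ∑ c₂ : Fin μ → Bool, ∑ c₃ : Fin μ → Bool, mathTerm F x ρ i κ pos ![digits μ v₀, digits μ v₁, c₂, c₃]) =
      ∑ c₁ : Fin μ → Bool, ∑ c₂ : Fin μ → Bool, ∑ c₃ : Fin μ → Bool, mathTerm F x ρ i κ pos ![digits μ v₀, c₁, c₂, c₃] from fun v₀ =>
    sum_range_two_pow_eq_sum_fn μ (fun c₁ => ∑ c₂ : Fin μ → Bool, ∑ c₃ : Fin μ → Bool, mathTerm F x ρ i κ pos ![digits μ v₀, c₁, c₂, c₃])]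
  exact sum_range_two_pow_eq_sum_fn μ (fun c₀ => ∑ c₁ : Fin μ → Bool, ∑ c₂ : Fin μ → Bool, ∑ c₃ : Fin μ → Bool,
    mathTerm F x ρ i κ pos ![c₀, c₁, c₂, c₃])

end Nested

/-! ### The sums as the path-tuple sums of the moments file -/

section Bridge

variable (F : QCircuitFamily cliffordT) (x : List Bool)
variable (ρ : List (Fin (numOracleBits F x) × Bool)) (i : Fin (numOracleBits F x))

/-- The term of a kind is in `{−1, 0, 1}`. [folklore] -/
theorem termVal_mem (κ : Kind) (c : Fin 4 → (Fin (gts F x).length → Bool)) :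
    termVal F x κ c = 0 ∨ termVal F x κ c = 1 ∨ termVal F x κ c = -1 := by
  unfold termVal
  have h01 := letter_mem F x κ.bX (c 0) (c 1)
  have h23 := letter_mem F x κ.bY (c 2) (c 3)
  split_ifs
  · rcases h01 with h | h | h <;> rcases h23 with h' | h' | h' <;> simp [h, h']
  · exact h01

/-- **The difference of the positive and negative sums, termwise**: `[t = 1 ∧ C]·2^e − [t = −1 ∧ C]·2^e = t · ([C]·2^e)`
for `t ∈ {−1, 0, 1}`. [folklore] -/
theorem mathTerm_sub (κ : Kind) (c : Fin 4 → (Fin (gts F x).length → Bool)) :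
    (mathTerm F x ρ i κ true c : ℤ) - (mathTerm F x ρ i κ false c : ℤ) =
      termVal F x κ c * consWt F x ρ i (readList F x κ c) (κ.kfac * (gts F x).length) := by
  unfold mathTerm consWt
  simp only [↓reduceIte, Bool.false_eq_true]
  rcases termVal_mem F x κ c with h | h | h <;> rw [h] <;> by_cases hC : Cons ρ i (readList F x κ c) <;> simp [hC]

/-- **Quadruple kinds: `sumS κ ⊤ − sumS κ ⊥ = quadSum (letter bX) (letter bY) fl ρ i`.** [cite: AaronsonAmbainis2014, proof of Thm. 23 (p. 14)] -/
theorem sumS_quad_sub (bX bY fl : Bool) :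
    (sumS F ⟨true, bX, bY, fl⟩ true (encW F x ρ i) : ℤ) - (sumS F ⟨true, bX, bY, fl⟩ false (encW F x ρ i) : ℤ) =
      quadSum F x (letter F x bX) (letter F x bY) fl ρ i := by
  rw [sumS_encW, sumS_encW]
  push_cast
  simp only [← Finset.sum_sub_distrib, mathTerm_sub]
  unfold quadSum termVal readList Kind.kfac K2
  simp only [↓reduceIte, Matrix.cons_val_zero, Matrix.cons_val_one]
  refine Finset.sum_congr rfl fun c₀ _ => Finset.sum_congr rfl fun c₁ _ => Finset.sum_congr rfl fun c₂ _ =>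
    Finset.sum_congr rfl fun c₃ _ => ?_
  have h2 : (![c₀, c₁, c₂, c₃] : Fin 4 → (Fin (gts F x).length → Bool)) 2 = c₂ := rfl
  have h3 : (![c₀, c₁, c₂, c₃] : Fin 4 → (Fin (gts F x).length → Bool)) 3 = c₃ := rfl
  rw [h2, h3, show 4 * (gts F x).length = 2 * (2 * (accGates F x).length) by simp only [gts]; ring]

/-- **Pair kinds: `sumS κ ⊤ − sumS κ ⊥ = 2^{2μ} · pairSum (letter bX) ρ i`.** [cite: AaronsonAmbainis2014, proof of Thm. 23 (p. 14)] -/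
theorem sumS_pair_sub (bX bY fl : Bool) :
    (sumS F ⟨false, bX, bY, fl⟩ true (encW F x ρ i) : ℤ) - (sumS F ⟨false, bX, bY, fl⟩ false (encW F x ρ i) : ℤ) =
      2 ^ (2 * (gts F x).length) * pairSum F x (letter F x bX) ρ i := by
  rw [sumS_encW, sumS_encW]
  push_cast
  simp only [← Finset.sum_sub_distrib, mathTerm_sub]
  unfold pairSum termVal readList Kind.kfac K2
  simp only [Bool.false_eq_true, ↓reduceIte, Matrix.cons_val_zero, Matrix.cons_val_one]
  -- the sums over `c₂, c₃` are of a constant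
  simp only [Finset.sum_const, Finset.card_univ, Fintype.card_fun, Fintype.card_bool, Fintype.card_fin]
  rw [Finset.mul_sum]
  refine Finset.sum_congr rfl fun c₀ _ => ?_
  rw [Finset.mul_sum]
  refine Finset.sum_congr rfl fun c₁ _ => ?_
  ring

end Bridge

/-! ## Part 2 — the three exact tests as counting-hierarchy predicates -/

/-! ### Signed `CH`-graph functions -/

/-- An integer-valued function of words presented as a difference of two natural-valued ones. [folklore] -/
structure ZPair where
  /-- positive part -/
  pos : List Bool → ℕ
  /-- negative part -/
  neg : List Bool → ℕ

namespace ZPair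

/-- The value `pos − neg`. [folklore] -/
def val (a : ZPair) (w : List Bool) : ℤ := (a.pos w : ℤ) - (a.neg w : ℤ)

/-- Both parts are `CH`-graph functions. [folklore] -/
def IsCH (a : ZPair) : Prop := IsCHFn a.pos ∧ IsCHFn a.neg

/-- A natural-valued function. [folklore] -/
def ofNat (f : List Bool → ℕ) : ZPair := ⟨f, fun _ => 0⟩
/-- Sum. [folklore] -/
def add (a b : ZPair) : ZPair := ⟨fun w => a.pos w + b.pos w, fun w => a.neg w + b.neg w⟩
/-- Negation. [folklore] -/
def negate (a : ZPair) : ZPair := ⟨a.neg, a.pos⟩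
/-- Difference. [folklore] -/
def sub (a b : ZPair) : ZPair := a.add b.negate
/-- Product. [folklore] -/
def mul (a b : ZPair) : ZPair :=
  ⟨fun w => a.pos w * b.pos w + a.neg w * b.neg w, fun w => a.pos w * b.neg w + a.neg w * b.pos w⟩
/-- Multiple by a natural constant. [folklore] -/
def smul (c : ℕ) (a : ZPair) : ZPair := ⟨fun w => c * a.pos w, fun w => c * a.neg w⟩
/-- Multiple by a natural-valued function. [folklore] -/
def nmul (f : List Bool → ℕ) (a : ZPair) : ZPair := ⟨fun w => f w * a.pos w, fun w => f w * a.neg w⟩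

/-- Value of `ofNat`. [folklore] -/
@[simp] theorem val_ofNat (f : List Bool → ℕ) (w : List Bool) : (ofNat f).val w = f w := by simp [val, ofNat]
/-- Value of a sum. [folklore] -/
@[simp] theorem val_add (a b : ZPair) (w : List Bool) : (a.add b).val w = a.val w + b.val w := by
  simp [val, add]; ring
/-- Value of a negation. [folklore] -/
@[simp] theorem val_negate (a : ZPair) (w : List Bool) : a.negate.val w = -a.val w := by simp [val, negate]
/-- Value of a difference. [folklore] -/
@[simp] theorem val_sub (a b : ZPair) (w : List Bool) : (a.sub b).val w = a.val w - b.val w := by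
  simp [sub, sub_eq_add_neg]
/-- Value of a product. [folklore] -/
@[simp] theorem val_mul (a b : ZPair) (w : List Bool) : (a.mul b).val w = a.val w * b.val w := by
  simp [val, mul]; ring
/-- Value of a constant multiple. [folklore] -/
@[simp] theorem val_smul (c : ℕ) (a : ZPair) (w : List Bool) : (smul c a).val w = c * a.val w := by
  simp [val, smul]; ring
/-- Value of a function multiple. [folklore] -/
@[simp] theorem val_nmul (f : List Bool → ℕ) (a : ZPair) (w : List Bool) : (nmul f a).val w = f w * a.val w := by
  simp [val, nmul]; ring

/-- `ofNat` is `CH`. [folklore] -/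
theorem isCH_ofNat {f : List Bool → ℕ} (hf : IsCHFn f) : (ofNat f).IsCH := ⟨hf, IsCHFn.const 0⟩
/-- Sums are `CH`. [folklore] -/
theorem isCH_add {a b : ZPair} (ha : a.IsCH) (hb : b.IsCH) : (a.add b).IsCH := ⟨ha.1.add hb.1, ha.2.add hb.2⟩
/-- Negations are `CH`. [folklore] -/
theorem isCH_negate {a : ZPair} (ha : a.IsCH) : a.negate.IsCH := ⟨ha.2, ha.1⟩
/-- Differences are `CH`. [folklore] -/
theorem isCH_sub {a b : ZPair} (ha : a.IsCH) (hb : b.IsCH) : (a.sub b).IsCH := isCH_add ha (isCH_negate hb)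
/-- Products are `CH`. [folklore] -/
theorem isCH_mul {a b : ZPair} (ha : a.IsCH) (hb : b.IsCH) : (a.mul b).IsCH :=
  ⟨(ha.1.mul hb.1).add (ha.2.mul hb.2), (ha.1.mul hb.2).add (ha.2.mul hb.1)⟩
/-- Constant multiples are `CH`. [folklore] -/
theorem isCH_smul (c : ℕ) {a : ZPair} (ha : a.IsCH) : (smul c a).IsCH := ⟨(IsCHFn.const c).mul ha.1, (IsCHFn.const c).mul ha.2⟩
/-- Function multiples are `CH`. [folklore] -/
theorem isCH_nmul {f : List Bool → ℕ} (hf : IsCHFn f) {a : ZPair} (ha : a.IsCH) : (nmul f a).IsCH := ⟨hf.mul ha.1, hf.mul ha.2⟩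

/-- The absolute value in `ℕ` arithmetic. [folklore] -/
def nabs (a : ZPair) (w : List Bool) : ℕ := (a.pos w - a.neg w) + (a.neg w - a.pos w)

/-- `nabs` is the absolute value. [folklore] -/
theorem nabs_eq (a : ZPair) (w : List Bool) : (a.nabs w : ℤ) = |a.val w| := by
  unfold nabs val
  rcases le_total (a.pos w) (a.neg w) with h | h
  · rw [Nat.sub_eq_zero_of_le h, zero_add, abs_of_nonpos (by omega)]; push_cast [h]; ring
  · rw [Nat.sub_eq_zero_of_le h, add_zero, abs_of_nonneg (by omega)]; push_cast [h]; ring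

/-- `nabs` is a `CH`-graph function. [folklore] -/
theorem isCHFn_nabs {a : ZPair} (ha : a.IsCH) : IsCHFn a.nabs := (ha.1.tsub ha.2).add (ha.2.tsub ha.1)

/-- **The `√2`-sign test in `ℕ` arithmetic** on two signed functions:
`(a⁻ < a⁺ ∧ (b⁻ ≤ b⁺ ∨ 2|b|² < |a|²)) ∨ (a⁺ ≤ a⁻ ∧ b⁻ ≤ b⁺ ∧ |a|² < 2|b|²)`. [folklore] -/
def Pst (a b : ZPair) (w : List Bool) : Prop :=
  (a.neg w < a.pos w ∧ (b.neg w ≤ b.pos w ∨ 2 * (b.nabs w * b.nabs w) < a.nabs w * a.nabs w)) ∨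
    (a.pos w ≤ a.neg w ∧ b.neg w ≤ b.pos w ∧ a.nabs w * a.nabs w < 2 * (b.nabs w * b.nabs w))

/-- **`Pst a b ↔ posSqrtTwoTest (val a) (val b)`**, i.e. `0 < a + b√2`. [cite: AaronsonAmbainis2014, proof of Thm. 23 (p. 14: the tests are exact)] -/
theorem pst_iff (a b : ZPair) (w : List Bool) : Pst a b w ↔ posSqrtTwoTest (a.val w) (b.val w) = true := by
  unfold Pst posSqrtTwoTest
  have ha := nabs_eq a w
  have hb := nabs_eq b w
  have hsqa : ((a.nabs w * a.nabs w : ℕ) : ℤ) = a.val w * a.val w := by push_cast; rw [ha, ← abs_mul, abs_mul_self]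
  have hsqb : ((b.nabs w * b.nabs w : ℕ) : ℤ) = b.val w * b.val w := by push_cast; rw [hb, ← abs_mul, abs_mul_self]
  have h1 : a.neg w < a.pos w ↔ 0 < a.val w := by unfold val; omega
  have h2 : b.neg w ≤ b.pos w ↔ 0 ≤ b.val w := by unfold val; omega
  have h3 : a.pos w ≤ a.neg w ↔ a.val w ≤ 0 := by unfold val; omega
  have h4 : 2 * (b.nabs w * b.nabs w) < a.nabs w * a.nabs w ↔ 2 * b.val w * b.val w < a.val w * a.val w := by
    rw [mul_assoc, ← hsqa, ← hsqb]; norm_cast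
  have h5 : a.nabs w * a.nabs w < 2 * (b.nabs w * b.nabs w) ↔ a.val w * a.val w < 2 * b.val w * b.val w := by
    rw [mul_assoc, ← hsqa, ← hsqb]; norm_cast
  rw [h1, h2, h3, h4, h5]
  simp only [Bool.or_eq_true, Bool.and_eq_true, decide_eq_true_eq]

/-- **The sign test is a `CH` predicate.** [cite: Toran1991, §4] -/
theorem pst_mem_CH {a b : ZPair} (ha : a.IsCH) (hb : b.IsCH) : ({w | Pst a b w} : Language Bool) ∈ CH := by
  have hna := isCHFn_nabs ha
  have hnb := isCHFn_nabs hb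
  have hsa := hna.mul hna
  have hsb := (IsCHFn.const 2).mul (hnb.mul hnb)
  unfold Pst
  exact or_mem_CH (and_mem_CH (IsCHFn.lt_mem_CH ha.2 ha.1) (or_mem_CH (IsCHFn.le_mem_CH hb.2 hb.1) (IsCHFn.lt_mem_CH hsb hsa)))
    (and_mem_CH (IsCHFn.le_mem_CH ha.1 ha.2) (and_mem_CH (IsCHFn.le_mem_CH hb.2 hb.1) (IsCHFn.lt_mem_CH hsa hsb)))

/-- **The test `¬(0 < a + b√2)` is a `CH` predicate.** [cite: Toran1991, §4] -/
theorem test_mem_CH {a b : ZPair} (ha : a.IsCH) (hb : b.IsCH) :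
    ({w | posSqrtTwoTest (a.val w) (b.val w) = false} : Language Bool) ∈ CH :=
  mem_CH_of_iff (not_mem_CH (pst_mem_CH ha hb)) _ fun w => by
    change posSqrtTwoTest (a.val w) (b.val w) = false ↔ ¬ Pst a b w; rw [pst_iff, Bool.not_eq_true]

end ZPair

/-- **Scaling invariance of the sign test**: `posSqrtTwoTest (m a) (m b) = posSqrtTwoTest a b` for `m > 0`. [folklore] -/
theorem posSqrtTwoTest_mul {m : ℤ} (hm : 0 < m) (a b : ℤ) : posSqrtTwoTest (m * a) (m * b) = posSqrtTwoTest a b := by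
  apply Bool.eq_iff_iff.2
  rw [posSqrtTwoTest_iff, posSqrtTwoTest_iff]
  push_cast
  have hm' : (0 : ℝ) < m := by exact_mod_cast hm
  constructor
  · intro h; nlinarith [h, hm']
  · intro h; nlinarith [h, hm']

/-- Powers of a `CH`-graph function by a constant exponent. [folklore] -/
theorem isCHFn_npow {f : List Bool → ℕ} (hf : IsCHFn f) : ∀ c : ℕ, IsCHFn fun w => f w ^ c
  | 0 => (IsCHFn.const 1).congr fun w => by simp
  | c + 1 => ((isCHFn_npow hf c).mul hf).congr fun w => by rw [pow_succ]

/-! ### The node quantities on the coded node -/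

section Node

variable (F : QCircuitFamily cliffordT)

/-- The record of `W` with four empty coin strings (for the coin-independent counts). [folklore] -/
def padR : List Bool → List Bool :=
  pairFn (pairFn (pairFn (pairFn (fun w => w) (fun _ => [])) (fun _ => [])) (fun _ => [])) (fun _ => [])

/-- `padR ∈ FP`. [folklore] -/
theorem padR_mem_FP : padR ∈ FP :=
  pairFn_mem_FP (pairFn_mem_FP (pairFn_mem_FP (pairFn_mem_FP (PolyTimeComputable.id _) (const_mem_FP [])) (const_mem_FP []))
    (const_mem_FP [])) (const_mem_FP [])

/-- `padR` as pairing: the record `mkR W ε ε ε ε`. [folklore] -/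
theorem padR_apply (W : List Bool) : padR W = mkR W [] [] [] [] := by simp [padR, mkR, pairFn_apply]

/-- The length of the padded record. [folklore] -/
theorem length_padR (W : List Bool) : (padR W).length = 16 * W.length + 30 := by
  rw [padR_apply]; simp only [mkR, length_boolPair, List.length_nil]; ring

/-- **The number of gates `μ`**, on `W`. [folklore] -/
def muW : List Bool → ℕ := fun W => NGates F (padR W)
/-- **The number of Hadamard gates `h`**, on `W`. [folklore] -/
def hW : List Bool → ℕ := fun W => NHad F (padR W)
/-- **The number of oracle gates**, on `W`. [folklore] -/
def oqW : List Bool → ℕ := fun W => NOrc F (padR W)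
/-- **The input length `n`**, on `W`. [folklore] -/
def nW : List Bool → ℕ := fun W => (fstP W).length

variable {F} (hU : F.IsUniform)
include hU

/-- The counts are `CH`-graph functions on `W`, each `≤ 16|W| + 30`. [folklore] -/
theorem countsW_isCHFn : (IsCHFn (muW F) ∧ ∀ W, muW F W ≤ 16 * W.length + 30) ∧
    (IsCHFn (hW F) ∧ ∀ W, hW F W ≤ 16 * W.length + 30) ∧ (IsCHFn (oqW F) ∧ ∀ W, oqW F W ≤ 16 * W.length + 30) := by
  obtain ⟨hN, hH, hO⟩ := counts_isCHFn hU
  have hb : ∀ (W : List Bool) (P : ℕ → Prop),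
      ((range (2 ^ (X : Polynomial ℕ).eval (padR W).length)).filter fun t => t < (dR (padR W)).length ∧ P t).card ≤
        16 * W.length + 30 := fun W P =>
    (card_filter_lt_le _ _ _).trans ((length_dR_le _).1.trans (length_padR W).le)
  exact ⟨⟨hN.comp_FP padR_mem_FP, fun W => hb W _⟩, ⟨hH.comp_FP padR_mem_FP, fun W => hb W _⟩,
    ⟨hO.comp_FP padR_mem_FP, fun W => hb W _⟩⟩

omit hU in
/-- `nW` is a `CH`-graph function, `≤ |W|`. [folklore] -/
theorem nW_isCHFn : IsCHFn nW ∧ ∀ W, nW W ≤ W.length := ⟨IsCHFn.length_FP fstP_mem_FP, fun W => length_fstP_le W⟩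

/-- Powers of two of an affine combination `α·h + β·μ + γ` of the counts are `CH`-graph functions. [folklore] -/
theorem pow2_counts_isCHFn (α β γ : ℕ) : IsCHFn fun W => 2 ^ (α * hW F W + β * muW F W + γ) := by
  obtain ⟨⟨hμ, hμb⟩, ⟨hh, hhb⟩, -⟩ := countsW_isCHFn hU
  refine ((((IsCHFn.const α).mul hh).add ((IsCHFn.const β).mul hμ)).add (IsCHFn.const γ)).pow2
    ⟨C α * (16 * X + 30) + C β * (16 * X + 30) + C γ, fun W => ?_⟩
  simp only [eval_add, eval_mul, eval_C, eval_X, eval_ofNat]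
  have h1 := hhb W; have h2 := hμb W
  have : α * hW F W ≤ α * (16 * W.length + 30) := Nat.mul_le_mul_left _ h1
  have : β * muW F W ≤ β * (16 * W.length + 30) := Nat.mul_le_mul_left _ h2
  omega

variable (F) in
/-- **The signed pair sum** `2^{2μ}·pairSum t_X`, on `W` (`X = A` for `bX = false`, `B` for `true`). [cite: AaronsonAmbainis2014, proof of Thm. 23 (p. 14)] -/
def SPz (bX : Bool) : ZPair :=
  (ZPair.ofNat (sumS F ⟨false, bX, false, false⟩ true)).sub (ZPair.ofNat (sumS F ⟨false, bX, false, false⟩ false))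

variable (F) in
/-- **The signed quadruple sum** `quadSum t_X t_Y fl`, on `W`. [cite: AaronsonAmbainis2014, proof of Thm. 23 (p. 14)] -/
def SQz (bX bY fl : Bool) : ZPair :=
  (ZPair.ofNat (sumS F ⟨true, bX, bY, fl⟩ true)).sub (ZPair.ofNat (sumS F ⟨true, bX, bY, fl⟩ false))

/-- The signed sums are `CH`. [folklore] -/
theorem sPz_sQz_isCH (bX bY fl : Bool) : (SPz F bX).IsCH ∧ (SQz F bX bY fl).IsCH :=
  ⟨ZPair.isCH_sub (ZPair.isCH_ofNat (isCHFn_sumS hU _ _).2.2.2) (ZPair.isCH_ofNat (isCHFn_sumS hU _ _).2.2.2),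
    ZPair.isCH_sub (ZPair.isCH_ofNat (isCHFn_sumS hU _ _).2.2.2) (ZPair.isCH_ofNat (isCHFn_sumS hU _ _).2.2.2)⟩

/-! #### The three tests -/

variable (F) in
/-- The integers of the output test, scaled by `2^{2μ}`: `a = 2^{h+1+4μ} − 4·(2^{2μ}p_A)`, `b = −2·(2^{2μ}p_B)`. [cite: AaronsonAmbainis2014, proof of Thm. 23 (p. 14: "E[p_j] ≥ 1/2")] -/
def outA : ZPair := (ZPair.ofNat fun W => 2 ^ (1 * hW F W + 4 * muW F W + 1)).sub (ZPair.smul 4 (SPz F false))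
/-- (second integer of the output test) [folklore] -/
def outB (F : QCircuitFamily cliffordT) : ZPair := (ZPair.smul 2 (SPz F true)).negate

variable (F) in
/-- **The output test language**: `¬(0 < a + b√2)`, i.e. `E[p_ρ] ≥ 1/2`. [cite: AaronsonAmbainis2014, proof of Thm. 23 (p. 14), Cor. 22] -/
def outL : Language Bool := {W | posSqrtTwoTest ((outA F).val W) ((outB F).val W) = false}

/-- **`outL ∈ CH`.** [cite: AaronsonAmbainis2014, proof of Thm. 23 (p. 14: "we can use P^{#P} to decide whether E[p_j] ≥ 1/2")] -/
theorem outL_mem_CH : outL F ∈ CH := by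
  obtain ⟨hPA, -⟩ := sPz_sQz_isCH hU false false false
  obtain ⟨hPB, -⟩ := sPz_sQz_isCH hU true false false
  exact ZPair.test_mem_CH (ZPair.isCH_sub (ZPair.isCH_ofNat (pow2_counts_isCHFn hU 1 4 1)) (ZPair.isCH_smul 4 hPA))
    (ZPair.isCH_negate (ZPair.isCH_smul 2 hPB))

/-- The denominator `v_θ = 400 n³` of the variance threshold `θ = ε²δ/2` (`ε = 1/10`, `δ = 1/(2n³)`). [cite: AaronsonAmbainis2014, proof of Thm. 23 (p. 14)] -/
def vTheta : List Bool → ℕ := fun W => 400 * nW W ^ 3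

variable (F) in
/-- The integers of the variance test, scaled by `2^{4μ}`. [cite: AaronsonAmbainis2014, proof of Thm. 23 (p. 14: "Vr[p_j] ≤ …")] -/
def varAz : ZPair :=
  (ZPair.nmul (vTheta)
    ((ZPair.nmul (fun W => 2 ^ (0 * hW F W + 4 * muW F W + 0))
        ((ZPair.smul 4 (SQz F false false false)).add (ZPair.smul 2 (SQz F true true false)))).sub
      ((ZPair.smul 4 ((SPz F false).mul (SPz F false))).add (ZPair.smul 2 ((SPz F true).mul (SPz F true)))))).sub
    (ZPair.ofNat fun W => 2 ^ (2 * hW F W + 8 * muW F W + 2))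
/-- (second integer of the variance test) [folklore] -/
def varBz (F : QCircuitFamily cliffordT) : ZPair :=
  ZPair.nmul (vTheta)
    ((ZPair.nmul (fun W => 2 ^ (0 * hW F W + 4 * muW F W + 0))
        (ZPair.smul 2 ((SQz F false true false).add (SQz F true false false)))).sub
      (ZPair.smul 4 ((SPz F false).mul (SPz F true))))

variable (F) in
/-- **The halting-by-variance test language**: `Vr[p_ρ] ≤ 1/(400n³)`. [cite: AaronsonAmbainis2014, proof of Thm. 23 (p. 14), Thm. 21] -/
def varL : Language Bool := {W | posSqrtTwoTest ((varAz F).val W) ((varBz F).val W) = false}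

/-- **`varL ∈ CH`.** [cite: AaronsonAmbainis2014, proof of Thm. 23 (p. 14: "Vr[p_j] … in the second level of the counting hierarchy")] -/
theorem varL_mem_CH : varL F ∈ CH := by
  obtain ⟨hPA, hQAA⟩ := sPz_sQz_isCH hU false false false
  obtain ⟨hPB, hQBB⟩ := sPz_sQz_isCH hU true true false
  obtain ⟨-, hQAB⟩ := sPz_sQz_isCH hU false true false
  obtain ⟨-, hQBA⟩ := sPz_sQz_isCH hU true false false
  have hv : IsCHFn vTheta := (IsCHFn.const 400).mul (isCHFn_npow nW_isCHFn.1 3)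
  have hp4 := pow2_counts_isCHFn hU 0 4 0
  refine ZPair.test_mem_CH ?_ ?_
  · exact ZPair.isCH_sub (ZPair.isCH_nmul hv (ZPair.isCH_sub (ZPair.isCH_nmul hp4 (ZPair.isCH_add (ZPair.isCH_smul 4 hQAA)
      (ZPair.isCH_smul 2 hQBB))) (ZPair.isCH_add (ZPair.isCH_smul 4 (ZPair.isCH_mul hPA hPA)) (ZPair.isCH_smul 2 (ZPair.isCH_mul hPB hPB)))))
      (ZPair.isCH_ofNat (pow2_counts_isCHFn hU 2 8 2))
  · exact ZPair.isCH_nmul hv (ZPair.isCH_sub (ZPair.isCH_nmul hp4 (ZPair.isCH_smul 2 (ZPair.isCH_add hQAB hQBA)))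
      (ZPair.isCH_smul 4 (ZPair.isCH_mul hPA hPB)))

variable (F) in
/-- The denominator `v_w = 2^k (400 n³ d)^c` of the influence threshold `w = 2^{-k} (θ/d)^c`,
`d = 2·(#oracle gates) + 1`. [cite: AaronsonAmbainis2014, proof of Thm. 23 (p. 14)] -/
def vInf (c k : ℕ) : List Bool → ℕ := fun W => 2 ^ k * (400 * nW W ^ 3 * (2 * oqW F W + 1)) ^ c

variable (F) in
/-- The integers of the influence test. [cite: AaronsonAmbainis2014, proof of Thm. 23 (p. 14: "Inf_i[p_j] ≥ …")] -/
def infAz (c k : ℕ) : ZPair :=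
  (ZPair.ofNat fun W => 2 ^ (2 * hW F W + 4 * muW F W + 2)).sub
    (ZPair.nmul (vInf F c k) ((ZPair.smul 8 ((SQz F false false false).sub (SQz F false false true))).add
      (ZPair.smul 4 ((SQz F true true false).sub (SQz F true true true)))))
/-- (second integer of the influence test) [folklore] -/
def infBz (F : QCircuitFamily cliffordT) (c k : ℕ) : ZPair :=
  (ZPair.nmul (vInf F c k) (ZPair.smul 4 (((SQz F false true false).add (SQz F true false false)).sub
    ((SQz F false true true).add (SQz F true false true))))).negate

variable (F) in
/-- **The query-by-influence test language**: `1/(2^k (400 n³ d)^c) ≤ Inf_i[p_ρ]`. [cite: AaronsonAmbainis2014, proof of Thm. 23 (p. 14), Thm. 21] -/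
def infL (c k : ℕ) : Language Bool := {W | posSqrtTwoTest ((infAz F c k).val W) ((infBz F c k).val W) = false}

/-- **`infL ∈ CH`.** [cite: AaronsonAmbainis2014, proof of Thm. 23 (p. 14: "Inf_i[p_j] … in the counting hierarchy")] -/
theorem infL_mem_CH (c k : ℕ) : infL F c k ∈ CH := by
  have hQ := fun bX bY fl => (sPz_sQz_isCH hU bX bY fl).2
  obtain ⟨⟨-, -⟩, ⟨-, -⟩, ⟨hO, -⟩⟩ := countsW_isCHFn hU
  have hv : IsCHFn (vInf F c k) := (IsCHFn.const _).mul (isCHFn_npow ((((IsCHFn.const 400).mul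
    (isCHFn_npow nW_isCHFn.1 3)).mul (((IsCHFn.const 2).mul hO).add (IsCHFn.const 1)))) c)
  refine ZPair.test_mem_CH ?_ ?_
  · exact ZPair.isCH_sub (ZPair.isCH_ofNat (pow2_counts_isCHFn hU 2 4 2)) (ZPair.isCH_nmul hv (ZPair.isCH_add
      (ZPair.isCH_smul 8 (ZPair.isCH_sub (hQ false false false) (hQ false false true)))
      (ZPair.isCH_smul 4 (ZPair.isCH_sub (hQ true true false) (hQ true true true)))))
  · exact ZPair.isCH_negate (ZPair.isCH_nmul hv (ZPair.isCH_smul 4 (ZPair.isCH_sub (ZPair.isCH_add (hQ false true false)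
      (hQ true false false)) (ZPair.isCH_add (hQ false true true) (hQ true false true)))))

end Node

/-! ### The meaning of the tests on a coded node -/

section TestSem

variable (F : QCircuitFamily cliffordT) (x : List Bool)
variable (ρ : List (Fin (numOracleBits F x) × Bool)) (i : Fin (numOracleBits F x))

/-- The padded coded node reads `x` and `descFn x`. [folklore] -/
theorem access_padR_encW : xR (padR (encW F x ρ i)) = x ∧ dR (padR (encW F x ρ i)) = F.descFn x := by
  rw [padR_apply]
  obtain ⟨-, hx, hd, -⟩ := access_mkR x (F.descFn x) (encRho ρ) (encodeNat i) [] [] [] []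
  exact ⟨hx, hd⟩

/-- **The counts on the coded node**: `μ`, `h`, the number of oracle gates, `n`. [folklore] -/
theorem counts_encW : muW F (encW F x ρ i) = (gts F x).length ∧ hW F (encW F x ρ i) = hCount (gts F x) ∧
    oqW F (encW F x ρ i) = (F.circ x.length).oracleQueries ∧ nW (encW F x ρ i) = x.length := by
  obtain ⟨hx, hd⟩ := access_padR_encW F x ρ i
  refine ⟨nGates_eq F x hx hd, nHad_eq F x hx hd, ?_, ?_⟩
  · unfold oqW; rw [nOrc_eq F x hx hd, countP_isOracleB_eq]
  · unfold nW encW; rw [fstP_boolPair]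

/-- The letters are the pair weights `tA`, `tB`. [folklore] -/
theorem letter_eq : letter F x false = tA F x ∧ letter F x true = tB F x := ⟨rfl, rfl⟩

/-- **The signed sums on the coded node.** [folklore] -/
theorem sPz_sQz_val (bX bY fl : Bool) :
    (SPz F bX).val (encW F x ρ i) = 2 ^ (2 * (gts F x).length) * pairSum F x (letter F x bX) ρ i ∧
    (SQz F bX bY fl).val (encW F x ρ i) = quadSum F x (letter F x bX) (letter F x bY) fl ρ i := by
  constructor
  · unfold SPz; rw [ZPair.val_sub, ZPair.val_ofNat, ZPair.val_ofNat]; exact sumS_pair_sub F x ρ i bX false false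
  · unfold SQz; rw [ZPair.val_sub, ZPair.val_ofNat, ZPair.val_ofNat]; exact sumS_quad_sub F x ρ i bX bY fl

/-- `K2 = 2μ` and `accGates = gts`. [folklore] -/
theorem k2_eq : K2 F x = 2 * (gts F x).length := rfl

/-- **The output test language decides `E[p_ρ] ≥ 1/2`.** [cite: AaronsonAmbainis2014, proof of Thm. 23 (p. 14), Cor. 22] -/
theorem mem_outL_iff :
    encW F x ρ i ∈ outL F ↔ (1 : ℝ) / 2 ≤ boolAvg (evalBool (ClassicalSimulation.nodePoly (acceptPoly F x) ρ)) := by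
  obtain ⟨hμ, hh, -, -⟩ := counts_encW F x ρ i
  have hA := (sPz_sQz_val F x ρ i false false false).1
  have hB := (sPz_sQz_val F x ρ i true false false).1
  rw [half_le_boolAvg_nodePoly_iff F x ρ i, ← posSqrtTwoTest_mul (m := 2 ^ (2 * (gts F x).length)) (by positivity)]
  change posSqrtTwoTest ((outA F).val (encW F x ρ i)) ((outB F).val (encW F x ρ i)) = false ↔ _
  unfold outA outB
  simp only [ZPair.val_sub, ZPair.val_ofNat, ZPair.val_smul, ZPair.val_negate, hA, hB, hμ, hh, (letter_eq F x).1,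
    (letter_eq F x).2, k2_eq]
  constructor <;> intro h <;> convert h using 2 <;> push_cast <;> ring

/-- **The variance test language decides `Vr[p_ρ] ≤ 1/(400 n³)`.** [cite: AaronsonAmbainis2014, proof of Thm. 23 (p. 14), Thm. 21] -/
theorem mem_varL_iff (hn : 1 ≤ x.length) :
    encW F x ρ i ∈ varL F ↔
      boolVariance (ClassicalSimulation.nodePoly (acceptPoly F x) ρ) ≤ ((1 : ℕ) : ℝ) / ((400 * x.length ^ 3 : ℕ) : ℝ) := by
  obtain ⟨hμ, hh, -, hnn⟩ := counts_encW F x ρ i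
  have hPA := (sPz_sQz_val F x ρ i false false false).1
  have hPB := (sPz_sQz_val F x ρ i true true false).1
  have hQAA := (sPz_sQz_val F x ρ i false false false).2
  have hQBB := (sPz_sQz_val F x ρ i true true false).2
  have hQAB := (sPz_sQz_val F x ρ i false true false).2
  have hQBA := (sPz_sQz_val F x ρ i true false false).2
  have hv : 0 < 400 * x.length ^ 3 := by positivity
  rw [boolVariance_nodePoly_le_iff F x ρ i 1 hv, ← posSqrtTwoTest_mul (m := 2 ^ (4 * (gts F x).length)) (by positivity)]
  change posSqrtTwoTest ((varAz F).val (encW F x ρ i)) ((varBz F).val (encW F x ρ i)) = false ↔ _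
  unfold varAz varBz vTheta varA varB D2
  simp only [ZPair.val_sub, ZPair.val_add, ZPair.val_ofNat, ZPair.val_smul, ZPair.val_nmul, ZPair.val_mul,
    hPA, hPB, hQAA, hQBB, hQAB, hQBA, hμ, hh, hnn, (letter_eq F x).1, (letter_eq F x).2, k2_eq]
  constructor <;> intro h <;> convert h using 2 <;> push_cast <;> ring

/-- **The influence test language decides `1/(2^k (400 n³ d)^c) ≤ Inf_i[p_ρ]`**, `d = thm23Degree F x`. [cite: AaronsonAmbainis2014, proof of Thm. 23 (p. 14), Thm. 21] -/
theorem mem_infL_iff (c k : ℕ) (hn : 1 ≤ x.length) :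
    encW F x ρ i ∈ infL F c k ↔
      ((1 : ℕ) : ℝ) / ((2 ^ k * (400 * x.length ^ 3 * thm23Degree F x) ^ c : ℕ) : ℝ) ≤
        influence i (ClassicalSimulation.nodePoly (acceptPoly F x) ρ) := by
  obtain ⟨hμ, hh, hoq, hnn⟩ := counts_encW F x ρ i
  have hQ := fun bX bY fl => (sPz_sQz_val F x ρ i bX bY fl).2
  have hv : 0 < 2 ^ k * (400 * x.length ^ 3 * thm23Degree F x) ^ c := by unfold thm23Degree; positivity
  rw [div_le_influence_nodePoly_iff F x ρ i 1 hv]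
  change posSqrtTwoTest ((infAz F c k).val (encW F x ρ i)) ((infBz F c k).val (encW F x ρ i)) = false ↔ _
  have hdeg : 2 * oqW F (encW F x ρ i) + 1 = thm23Degree F x := by rw [hoq]; rfl
  unfold infAz infBz vInf infA infB D2
  simp only [ZPair.val_sub, ZPair.val_add, ZPair.val_ofNat, ZPair.val_smul, ZPair.val_nmul, ZPair.val_negate,
    hQ, hμ, hh, hnn, hdeg, (letter_eq F x).1, (letter_eq F x).2, k2_eq]
  constructor <;> intro h <;> convert h using 2 <;> push_cast <;> ring

end TestSem

/-! ## Part 3 — the query generator and the evaluator -/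

/-! ### More formula-layer rules -/

section DSL

/-- **Bits of a `CH`-graph function at a polynomially bounded `CH`-graph position**: via
`testBit n j ↔ n / 2^j mod 2 = 1`. [cite: Burgisser2006, Remark 3.2] -/
theorem testBit_mem_CH {f g : List Bool → ℕ} (hf : IsCHFn f) (hg : IsCHFn g) (hb : ∃ p : Polynomial ℕ, ∀ w, g w ≤ p.eval w.length) :
    ({w | (f w).testBit (g w) = true} : Language Bool) ∈ CH :=
  mem_CH_of_iff (IsCHFn.eq_mem_CH ((hf.div (hg.pow2 hb)).mod (IsCHFn.const 2)) (IsCHFn.const 1)) _ fun w => by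
    change (f w).testBit (g w) = true ↔ f w / 2 ^ g w % 2 = 1
    rw [Nat.testBit_eq_decide_div_mod_eq, decide_eq_true_iff]

end DSL

/-! ### The node word and its counting-hierarchy predicates -/

section Preds

variable (F : QCircuitFamily cliffordT) (c k : ℕ)

/-- `x` of `W = ⟨x, ⟨d, ⟨ρ̂, î⟩⟩⟩`. [folklore] -/
def xWf : List Bool → List Bool := fstP
/-- `d`. [folklore] -/
def dWf : List Bool → List Bool := fstP ∘ sndP
/-- `ρ̂`. [folklore] -/
def rhoWf : List Bool → List Bool := fstP ∘ sndP ∘ sndP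

/-- The accessors are in `FP`. [folklore] -/
theorem wAcc_mem_FP : xWf ∈ FP ∧ dWf ∈ FP ∧ rhoWf ∈ FP :=
  ⟨fstP_mem_FP, comp_mem_FP fstP_mem_FP sndP_mem_FP, comp_mem_FP fstP_mem_FP (comp_mem_FP sndP_mem_FP sndP_mem_FP)⟩

/-- **The width** `n + m` (input wires plus the unary ancilla count of the description). [folklore] -/
def widthW (W : List Bool) : ℕ := (xWf W).length + (fstP (sndP (dWf W))).length

/-- **`M = 2^width − 1`**, the number of oracle bits. [folklore] -/
def bigM (W : List Bool) : ℕ := 2 ^ widthW W - 1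

/-- **The number of restrictions `|ρ|`.** [folklore] -/
def lenRho (W : List Bool) : ℕ :=
  ((range (2 ^ (X : Polynomial ℕ).eval W.length)).filter fun m => m < (rhoWf W).length ∧ RLive (rhoWf W) m).card

/-- **The budget** `⌈8d/(wδ)⌉ = 16·d·n³·2^k·(400 n³ d)^c`, `d = 2·(#oracle gates) + 1`. [cite: AaronsonAmbainis2014, proof of Thm. 23 (p. 14), Thm. 21] -/
def budgetD (W : List Bool) : ℕ :=
  16 * (2 * oqW F W + 1) * nW W ^ 3 * 2 ^ k * (400 * nW W ^ 3 * (2 * oqW F W + 1)) ^ c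

/-- **Halt**: budget exhausted or variance small. [cite: AaronsonAmbainis2014, Thm. 21 (the halting rule)] -/
def Halt (W : List Bool) : Prop := budgetD F c k W ≤ lenRho W ∨ W ∈ varL F

/-- The node word with the flip position set to `i`. [folklore] -/
def wAt (W : List Bool) (i : ℕ) : List Bool := boolPair (xWf W) (boolPair (dWf W) (boolPair (rhoWf W) (encodeNat i)))

/-- **Variable `i` is influential enough** (`w ≤ Inf_i[p_ρ]`). [cite: AaronsonAmbainis2014, proof of Thm. 23 (p. 14)] -/
def InfAt (W : List Bool) (i : ℕ) : Prop := wAt W i ∈ infL F c k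

/-- **`i` is the picked variable**: the least influential-enough index. [cite: AaronsonAmbainis2014, proof of Thm. 23 (p. 14: "finding an i such that Inf_i[p_j] > …")] -/
def IsPick (W : List Bool) (i : ℕ) : Prop := InfAt F c k W i ∧ ∀ i' < i, ¬ InfAt F c k W i'

/-- **Live**: not halted and some variable is influential enough (`nextVar ≠ none`). [folklore] -/
def Live (W : List Bool) : Prop := ¬ Halt F c k W ∧ ∃ i < bigM W, InfAt F c k W i

/-- **Bit `|s|` of the picked variable**, on `⟨W, s⟩`. [folklore] -/
def PickBitL : Language Bool :=
  {z | ∃ i < bigM (fstP z), IsPick F c k (fstP z) i ∧ i.testBit (sndP z).length = true}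

variable {F} (hU : F.IsUniform)
include hU

omit hU in
/-- `widthW`, `bigM`, `lenRho` are `CH`-graph functions; `widthW W ≤ |W|`. [folklore] -/
theorem widthM_isCHFn : (IsCHFn widthW ∧ ∀ W, widthW W ≤ W.length) ∧ IsCHFn bigM ∧ IsCHFn lenRho := by
  obtain ⟨hx, hd, hρ⟩ := wAcc_mem_FP
  have hw : IsCHFn widthW := (IsCHFn.length_FP hx).add (IsCHFn.length_FP (comp_mem_FP fstP_mem_FP (comp_mem_FP sndP_mem_FP hd)))
  have hwb : ∀ W, widthW W ≤ W.length := fun W => by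
    have h1 := length_fstP_le W
    have h2 := length_boolUnpair_parts_le W
    have h3 := length_boolUnpair_parts_le (sndP W)
    have h4 := length_boolUnpair_parts_le (fstP (sndP W))
    have h5 := length_boolUnpair_parts_le (sndP (fstP (sndP W)))
    change 2 * (fstP W).length + (sndP W).length ≤ W.length at h2
    change 2 * (fstP (sndP W)).length + (sndP (sndP W)).length ≤ (sndP W).length at h3
    change 2 * (fstP (fstP (sndP W))).length + (sndP (fstP (sndP W))).length ≤ (fstP (sndP W)).length at h4
    change 2 * (fstP (sndP (fstP (sndP W)))).length + (sndP (sndP (fstP (sndP W)))).length ≤ (sndP (fstP (sndP W))).length at h5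
    simp only [widthW, xWf, dWf, Function.comp_apply]
    omega
  have hρ1 : rhoWf ∘ fstP ∈ FP := comp_mem_FP (g := rhoWf) hρ fstP_mem_FP
  obtain ⟨hl, -, -⟩ := rhoAtoms_mem_CH hρ1 sndP_mem_FP
  refine ⟨⟨hw, hwb⟩, (hw.pow2 ⟨X, fun W => by rw [eval_X]; exact hwb W⟩).tsub (IsCHFn.const 1), ?_⟩
  exact IsCHFn.count (Φ := fun W m => m < (rhoWf W).length ∧ RLive (rhoWf W) m) X
    (and_mem_CH (IsCHFn.lt_mem_CH (IsCHFn.of_FP sndP_mem_FP) (IsCHFn.length_FP hρ1)) hl)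

/-- `budgetD` is a `CH`-graph function. [folklore] -/
theorem budgetD_isCHFn : IsCHFn (budgetD F c k) := by
  obtain ⟨-, -, ⟨hO, -⟩⟩ := countsW_isCHFn hU
  have hn3 := isCHFn_npow nW_isCHFn.1 3
  have hd : IsCHFn fun W => 2 * oqW F W + 1 := ((IsCHFn.const 2).mul hO).add (IsCHFn.const 1)
  unfold budgetD
  exact ((((IsCHFn.const 16).mul hd).mul hn3).mul (IsCHFn.const _)).mul (isCHFn_npow (((IsCHFn.const 400).mul hn3).mul hd) c)

/-- **`Halt` is a `CH` predicate.** [folklore] -/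
theorem halt_mem_CH : ({W | Halt F c k W} : Language Bool) ∈ CH :=
  or_mem_CH (IsCHFn.le_mem_CH (budgetD_isCHFn c k hU) (widthM_isCHFn).2.2)
    (mem_CH_of_iff (varL_mem_CH hU) _ fun _ => Iff.rfl)

/-- **`InfAt` at `FP`/`CH`-computed arguments is a `CH` predicate.** [folklore] -/
theorem infAt_mem_CH {aW at_ : List Bool → List Bool} (haW : aW ∈ FP) (hat : at_ ∈ FP) :
    ({w | InfAt F c k (aW w) (bitsToNat (at_ w))} : Language Bool) ∈ CH := by
  obtain ⟨hx, hd, hρ⟩ := wAcc_mem_FP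
  have hmap : pairFn (xWf ∘ aW) (pairFn (dWf ∘ aW) (pairFn (rhoWf ∘ aW) (norm ∘ at_))) ∈ FP :=
    pairFn_mem_FP (comp_mem_FP hx haW) (pairFn_mem_FP (comp_mem_FP hd haW) (pairFn_mem_FP (comp_mem_FP hρ haW)
      (comp_mem_FP norm_mem_FP hat)))
  refine mem_CH_of_iff (preimage_mem_CH (infL_mem_CH hU c k) hmap) _ fun w => ?_
  change wAt (aW w) (bitsToNat (at_ w)) ∈ infL F c k ↔
    pairFn (xWf ∘ aW) (pairFn (dWf ∘ aW) (pairFn (rhoWf ∘ aW) (norm ∘ at_))) w ∈ infL F c k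
  simp only [pairFn_apply, Function.comp_apply, norm_eq_encodeNat, wAt]

/-- **`IsPick` at `FP`-computed arguments is a `CH` predicate.** [folklore] -/
theorem isPick_mem_CH {aW at_ : List Bool → List Bool} (haW : aW ∈ FP) (hat : at_ ∈ FP) :
    ({w | IsPick F c k (aW w) (bitsToNat (at_ w))} : Language Bool) ∈ CH :=
  and_mem_CH (infAt_mem_CH c k hU haW hat)
    (forall_lt_fn_mem_CH (Φ := fun w i' => ¬ InfAt F c k (aW w) i') (IsCHFn.of_FP hat)
      (not_mem_CH (infAt_mem_CH c k hU (comp_mem_FP haW fstP_mem_FP) sndP_mem_FP)))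

/-- **`Live` is a `CH` predicate.** [folklore] -/
theorem live_mem_CH : ({W | Live F c k W} : Language Bool) ∈ CH :=
  and_mem_CH (not_mem_CH (halt_mem_CH c k hU))
    (exists_lt_fn_mem_CH (Φ := fun W i => InfAt F c k W i) (widthM_isCHFn).2.1
      (infAt_mem_CH c k hU fstP_mem_FP sndP_mem_FP))

/-- **`PickBitL ∈ CH`.** [folklore] -/
theorem pickBitL_mem_CH : PickBitL F c k ∈ CH := by
  have hbody : ({w | IsPick F c k (fstP (fstP w)) (bitsToNat (sndP w)) ∧ (bitsToNat (sndP w)).testBit (sndP (fstP w)).length = true} :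
      Language Bool) ∈ CH :=
    and_mem_CH (isPick_mem_CH c k hU (comp_mem_FP fstP_mem_FP fstP_mem_FP) sndP_mem_FP)
      (testBit_mem_CH (IsCHFn.of_FP sndP_mem_FP) (IsCHFn.length_FP (comp_mem_FP sndP_mem_FP fstP_mem_FP))
        ⟨X, fun w => by
          rw [eval_X]
          have h1 := length_boolUnpair_parts_le (fstP w)
          change 2 * (fstP (fstP w)).length + (sndP (fstP w)).length ≤ (fstP w).length at h1
          have h2 := length_fstP_le w
          omega⟩)
  exact exists_lt_fn_mem_CH (Φ := fun z i => IsPick F c k (fstP z) i ∧ i.testBit (sndP z).length = true)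
    ((widthM_isCHFn).2.1.comp_FP fstP_mem_FP) hbody

end Preds

/-! ### The generator and the evaluator, under the collapse -/

section Machine

variable (F : QCircuitFamily cliffordT) (c k : ℕ)

/-- The decided bit of a language, as a one-bit string function. [folklore] -/
def indic (L : Language Bool) : List Bool → List Bool := fun w => encodeBool (L.boolIndicator w)

/-- Its value. [folklore] -/
theorem indic_apply (L : Language Bool) (w : List Bool) : indic L w = [decide (w ∈ L)] := by
  change [L.boolIndicator w] = [decide (w ∈ L)]
  unfold Set.boolIndicator
  split_ifs with h
  · congr 1; exact (decide_eq_true h).symm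
  · congr 1; exact (decide_eq_false h).symm

/-- **One round of the bit loop**: on `⟨d, ⟨W, s⟩⟩` append the bit `[⟨W, s⟩ ∈ PickBitL]` to `s`. [folklore] -/
def pbRound : List Bool → List Bool :=
  pairFn fstP (pairFn (fstP ∘ sndP) (OracleCompose.concatFn ∘ pairFn (sndP ∘ sndP) (indic (PickBitL F c k) ∘ sndP)))

/-- **The picked index in binary** (`|⟨x, d⟩| ≥ width + 1` bits, little-endian; the yardstick
`⟨x, d⟩` depends on `x` only), on `W`. [cite: AaronsonAmbainis2014, proof of Thm. 23 (p. 14: "finding an i … is in the third level of the counting hierarchy")] -/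
def pickBitsFn : List Bool → List Bool :=
  sndP ∘ sndP ∘ (fun z => (pbRound F c k)^[(X : Polynomial ℕ).eval (boolUnpair z).1.length] z) ∘
    pairFn (pairFn xWf dWf) (pairFn (fun W => W) (fun _ => []))

/-- **The query string of an index numeral**: the `s` with `strNum s = val u`, i.e. `bin (val u + 1)`
without its last bit. [folklore] -/
def strOfFn : List Bool → List Bool :=
  takeFn ∘ pairFn (List.tail ∘ addFn ∘ pairFn (fun u => u) (fun _ => [true])) (addFn ∘ pairFn (fun u => u) (fun _ => [true]))

/-- Reversing a coded list (all items; the list is its own yardstick). [folklore] -/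
def revItemsFn : List Bool → List Bool := takeRevLF ∘ pairFn (fun y => y) (pairFn lenBinF (fun y => y))

/-- **The node word of the replay state** `⟨x, ρ̂ʳ⟩` (restrictions newest-first):
`⟨x, ⟨descFn x, ⟨reversed ρ̂ʳ, ε⟩⟩⟩`. [folklore] -/
def mkWFn : List Bool → List Bool :=
  pairFn fstP (pairFn (F.descFn ∘ fstP) (pairFn (revItemsFn ∘ sndP) (fun _ => [])))

/-- The new item `⟨pick bits, [answer bit]⟩` consed onto `ρ̂ʳ`, on the replay record
`⟨⟨x, bs⟩, ⟨bs', ρ̂ʳ⟩⟩`. [folklore] -/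
def consItemFn : List Bool → List Bool :=
  pairFn (pairFn (norm ∘ pickBitsFn F c k ∘ mkWFn F ∘ pairFn (fstP ∘ fstP) (sndP ∘ sndP)) (take1Fn ∘ fstP ∘ sndP)) (sndP ∘ sndP)

/-- The condition of a live round: answers left and the node live, one bit. [folklore] -/
def liveRoundT : List Bool → List Bool :=
  andFn (notFn (nilT (fstP ∘ sndP))) (indic {W | Live F c k W} ∘ mkWFn F ∘ pairFn (fstP ∘ fstP) (sndP ∘ sndP))

/-- **One generator round** on `⟨⟨x, bs⟩, ⟨bs', ρ̂ʳ⟩⟩`: consume one answer bit; if answers were left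
and the node is live, cons the item (picked index, answer bit). [cite: AaronsonAmbainis2014, Thm. 21 (one query of the simulation)] -/
def genRound : List Bool → List Bool :=
  pairFn fstP (pairFn (List.tail ∘ fstP ∘ sndP) (iteFn (liveRoundT F c k) (consItemFn F c k) (sndP ∘ sndP)))

/-- **The replay** of all answer bits, on `⟨x, bs⟩`: the final `ρ̂ʳ`. [folklore] -/
def genIter : List Bool → List Bool :=
  sndP ∘ sndP ∘ (fun z => (genRound F c k)^[(X : Polynomial ℕ).eval (boolUnpair z).1.length] z) ∘
    pairFn (fun u => u) (pairFn sndP (fun _ => []))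

/-- **The query generator `Q`** on `⟨x, answer bits⟩`: the query string of the picked variable of
the current node if it is live, else `ε`. [cite: AaronsonAmbainis2014, proof of Thm. 23 (p. 14)] -/
def genQ : List Bool → List Bool :=
  iteFn (indic {W | Live F c k W} ∘ mkWFn F ∘ pairFn fstP (genIter F c k))
    (strOfFn ∘ pickBitsFn F c k ∘ mkWFn F ∘ pairFn fstP (genIter F c k)) (fun _ => [])

/-- **The evaluator `D`**: the final node passes the output test `E[p_ρ] ≥ 1/2`. [cite: AaronsonAmbainis2014, proof of Thm. 23 (p. 14), Cor. 22] -/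
def evalD : Language Bool := {u | (mkWFn F ∘ pairFn fstP (genIter F c k)) u ∈ outL F}

variable {F} (hU : F.IsUniform) (hP : Classes.P = PSharpP)
include hU hP

omit hU in
/-- Under the collapse every `CH` language is in `P`. [cite: AaronsonAmbainis2014, proof of Thm. 23 (p. 14: "the entire counting hierarchy collapses to P")] -/
theorem mem_P_of_mem_CH {L : Language Bool} (hL : L ∈ CH) : L ∈ Classes.P := by
  rw [CH_eq_P_of_P_eq_PSharpP hP] at hL; exact hL

omit hU in
/-- Indicators of `CH` languages are in `FP` under the collapse. [folklore] -/
theorem indic_mem_FP {L : Language Bool} (hL : L ∈ CH) : indic L ∈ FP := indicatorFn_mem_FP (mem_P_of_mem_CH hP hL)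

/-- `pbRound ∈ FP`. [folklore] -/
theorem pbRound_mem_FP : pbRound F c k ∈ FP :=
  pairFn_mem_FP fstP_mem_FP (pairFn_mem_FP (comp_mem_FP fstP_mem_FP sndP_mem_FP) (comp_mem_FP OracleCompose.concatFn_mem_FP
    (pairFn_mem_FP (comp_mem_FP sndP_mem_FP sndP_mem_FP) (comp_mem_FP (indic_mem_FP hP (pickBitL_mem_CH c k hU)) sndP_mem_FP))))

omit hU hP in
/-- `pbRound` keeps the first field and grows by one bit. [folklore] -/
theorem pbRound_fst_growth (w : List Bool) : (boolUnpair (pbRound F c k w)).1 = (boolUnpair w).1 ∧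
    (pbRound F c k w).length ≤ w.length + 5 * ((boolUnpair w).1.length + 1) := by
  have h2 := length_boolUnpair_parts_le w
  have h3 := length_boolUnpair_parts_le (sndP w)
  change 2 * (fstP w).length + (sndP w).length ≤ w.length at h2
  change 2 * (fstP (sndP w)).length + (sndP (sndP w)).length ≤ (sndP w).length at h3
  constructor
  · simp [pbRound, pairFn_apply]; rfl
  · simp only [pbRound, pairFn_apply, Function.comp_apply, OracleCompose.concatFn_boolPair, indic_apply, length_boolPair,
      List.length_append, List.length_singleton]
    change 2 * (fstP w).length + 2 + (2 * (fstP (sndP w)).length + 2 + ((sndP (sndP w)).length + 1)) ≤ w.length + 5 * ((fstP w).length + 1)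
    omega

/-- **`pickBitsFn ∈ FP`.** [cite: AroraBarak2009, §1.3 (bounded loops)] -/
theorem pickBitsFn_mem_FP : pickBitsFn F c k ∈ FP := by
  have hit := iterate_mem_FP_of_growth (pbRound_mem_FP c k hU hP) 5 (fun w => (pbRound_fst_growth c k w).1)
    (fun w => (pbRound_fst_growth c k w).2) X
  have hinit : pairFn (pairFn xWf dWf) (pairFn (fun W => W) (fun _ => [])) ∈ FP :=
    pairFn_mem_FP (pairFn_mem_FP wAcc_mem_FP.1 wAcc_mem_FP.2.1) (pairFn_mem_FP (PolyTimeComputable.id _) (const_mem_FP []))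
  exact comp_mem_FP sndP_mem_FP (comp_mem_FP sndP_mem_FP (comp_mem_FP hit hinit))

omit hU hP in
/-- `strOfFn ∈ FP`, `revItemsFn ∈ FP`. [folklore] -/
theorem strOf_rev_mem_FP : strOfFn ∈ FP ∧ revItemsFn ∈ FP := by
  have hadd : addFn ∘ pairFn (fun u => u) (fun _ => [true]) ∈ FP :=
    comp_mem_FP addFn_mem_FP (pairFn_mem_FP (PolyTimeComputable.id _) (const_mem_FP _))
  exact ⟨comp_mem_FP takeFn_mem_FP (pairFn_mem_FP (comp_mem_FP tail_mem_FP hadd) hadd),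
    comp_mem_FP takeRevLF_mem_FP (pairFn_mem_FP (PolyTimeComputable.id _) (pairFn_mem_FP lenBinF_mem_FP (PolyTimeComputable.id _)))⟩

omit hP in
/-- `mkWFn ∈ FP`. [folklore] -/
theorem mkWFn_mem_FP : mkWFn F ∈ FP :=
  pairFn_mem_FP fstP_mem_FP (pairFn_mem_FP (comp_mem_FP (QCircuitFamily.descFn_mem_FP_of_isUniform hU) fstP_mem_FP)
    (pairFn_mem_FP (comp_mem_FP strOf_rev_mem_FP.2 sndP_mem_FP) (const_mem_FP [])))

/-- `genRound ∈ FP`. [folklore] -/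
theorem genRound_mem_FP : genRound F c k ∈ FP := by
  have hst : mkWFn F ∘ pairFn (fstP ∘ fstP) (sndP ∘ sndP) ∈ FP :=
    comp_mem_FP (mkWFn_mem_FP hU) (pairFn_mem_FP (comp_mem_FP fstP_mem_FP fstP_mem_FP) (comp_mem_FP sndP_mem_FP sndP_mem_FP))
  have hcons : consItemFn F c k ∈ FP :=
    pairFn_mem_FP (pairFn_mem_FP (comp_mem_FP norm_mem_FP (comp_mem_FP (pickBitsFn_mem_FP c k hU hP) hst))
      (comp_mem_FP take1Fn_mem_FP (comp_mem_FP fstP_mem_FP sndP_mem_FP))) (comp_mem_FP sndP_mem_FP sndP_mem_FP)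
  have hlive : liveRoundT F c k ∈ FP :=
    andFn_mem_FP (notFn_mem_FP (nilT_mem_FP (comp_mem_FP fstP_mem_FP sndP_mem_FP)))
      (comp_mem_FP (indic_mem_FP hP (live_mem_CH c k hU)) hst)
  exact pairFn_mem_FP fstP_mem_FP (pairFn_mem_FP (comp_mem_FP tail_mem_FP (comp_mem_FP fstP_mem_FP sndP_mem_FP))
    (iteFn_mem_FP hlive hcons (comp_mem_FP sndP_mem_FP sndP_mem_FP)))

end Machine

/-! ### The bit loop computes the picked index; growth of the generator round -/

section Growth

variable (F : QCircuitFamily cliffordT) (c k : ℕ)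

/-- Bit `j` of the picked variable of `W` (decided). [folklore] -/
def pbit (W : List Bool) (j : ℕ) : Bool := decide (∃ i < bigM W, IsPick F c k W i ∧ i.testBit j = true)

/-- One round of the bit loop on a record. [folklore] -/
theorem pbRound_apply (d W s : List Bool) :
    pbRound F c k (boolPair d (boolPair W s)) = boolPair d (boolPair W (s ++ [pbit F c k W s.length])) := by
  have hmem : (boolPair W s ∈ PickBitL F c k) ↔ ∃ i < bigM W, IsPick F c k W i ∧ i.testBit s.length = true := by
    change (∃ i < bigM (fstP (boolPair W s)), IsPick F c k (fstP (boolPair W s)) i ∧ i.testBit (sndP (boolPair W s)).length = true) ↔ _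
    rw [fstP_boolPair, sndP_boolPair]
  simp only [pbRound, pairFn_apply, Function.comp_apply, fstP_boolPair, sndP_boolPair, OracleCompose.concatFn_boolPair, indic_apply,
    hmem, pbit]

/-- **The bit loop**: `r` rounds append the bits `|s|, …, |s| + r − 1` of the picked variable. [folklore] -/
theorem pbRound_iterate (d W : List Bool) : ∀ (r : ℕ) (s : List Bool),
    (pbRound F c k)^[r] (boolPair d (boolPair W s)) =
      boolPair d (boolPair W (s ++ (List.range r).map fun t => pbit F c k W (s.length + t)))
  | 0, s => by simp
  | r + 1, s => by
    rw [Function.iterate_succ_apply, pbRound_apply, pbRound_iterate d W r, List.range_succ_eq_map, List.map_cons, List.map_map]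
    simp only [List.length_append, List.length_singleton, List.append_assoc, List.singleton_append, Nat.add_zero]
    congr 4
    refine List.map_congr_left fun t _ => ?_
    simp only [Function.comp_apply, Nat.succ_eq_add_one]; congr 1; omega

/-- **`pickBitsFn W` is the list of the first `|⟨x, d⟩|` bits of the picked variable.** [cite: AaronsonAmbainis2014, proof of Thm. 23 (p. 14)] -/
theorem pickBitsFn_apply (W : List Bool) :
    pickBitsFn F c k W = (List.range (boolPair (xWf W) (dWf W)).length).map fun t => pbit F c k W t := by
  simp only [pickBitsFn, Function.comp_apply, pairFn_apply, boolUnpair_boolPair, eval_X]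
  rw [pbRound_iterate]
  simp

/-- `|pickBitsFn W| = |⟨x, d⟩| = 2|x| + 2 + |d|`. [folklore] -/
theorem length_pickBitsFn (W : List Bool) : (pickBitsFn F c k W).length = 2 * (xWf W).length + 2 + (dWf W).length := by
  rw [pickBitsFn_apply]; simp

/-- `mkWFn` reads `x` and `d = descFn x`. [folklore] -/
theorem dWf_mkWFn (u : List Bool) : xWf (mkWFn F u) = fstP u ∧ dWf (mkWFn F u) = F.descFn (fstP u) := by
  simp [xWf, dWf, mkWFn, pairFn_apply]

/-- **Growth of one generator round**: the first field is kept and the record grows by at most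
`4(2|x| + 2 + |descFn x|) + 12`. [folklore] -/
theorem genRound_fst_growth (w : List Bool) :
    (boolUnpair (genRound F c k w)).1 = (boolUnpair w).1 ∧
      (genRound F c k w).length ≤ w.length + (4 * (2 * (fstP (fstP w)).length + 2 + (F.descFn (fstP (fstP w))).length) + 12) := by
  have h2 := length_boolUnpair_parts_le w
  have h3 := length_boolUnpair_parts_le (sndP w)
  change 2 * (fstP w).length + (sndP w).length ≤ w.length at h2
  change 2 * (fstP (sndP w)).length + (sndP (sndP w)).length ≤ (sndP w).length at h3
  have htail : (fstP (sndP w)).tail.length ≤ (fstP (sndP w)).length := by simp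
  have hpb : (norm (pickBitsFn F c k (mkWFn F (boolPair (fstP (fstP w)) (sndP (sndP w)))))).length ≤
      2 * (fstP (fstP w)).length + 2 + (F.descFn (fstP (fstP w))).length := by
    refine (length_norm_le _).trans ?_
    rw [length_pickBitsFn, (dWf_mkWFn F _).1, (dWf_mkWFn F _).2, fstP_boolPair]
  have ht1 : (take1Fn (fstP (sndP w))).length ≤ 1 := by simp [take1Fn]
  constructor
  · simp [genRound, pairFn_apply]; rfl
  · unfold genRound
    rw [pairFn_apply, pairFn_apply, length_boolPair, length_boolPair]
    have hite : (iteFn (liveRoundT F c k) (consItemFn F c k) (sndP ∘ sndP) w).length ≤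
        (sndP (sndP w)).length + (4 * (2 * (fstP (fstP w)).length + 2 + (F.descFn (fstP (fstP w))).length) + 8) := by
      have hone : ∃ b, liveRoundT F c k w = [b] := by
        unfold liveRoundT
        exact ⟨_, andFn_apply (notFn_apply (nilT_apply _ _)) (by rw [Function.comp_apply, indic_apply])⟩
      obtain ⟨b, hb⟩ := hone
      rw [iteFn_apply hb]
      cases b
      · simp
      · simp only [if_true, consItemFn, pairFn_apply, Function.comp_apply, length_boolPair]
        omega
    simp only [Function.comp_apply] at hite ⊢
    omega

variable {F} (hU : F.IsUniform) (hP : Classes.P = PSharpP)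
include hU hP

/-- **`genIter ∈ FP`** (polynomially many rounds of polynomial growth, `iterate_mem_FP_of_growth_poly`). [cite: AroraBarak2009, §1.3, §1.4.1] -/
theorem genIter_mem_FP : genIter F c k ∈ FP := by
  obtain ⟨sF, hsF⟩ := exists_poly_length_le_of_mem_FP (QCircuitFamily.descFn_mem_FP_of_isUniform hU)
  have hit := iterate_mem_FP_of_growth_poly (genRound_mem_FP c k hU hP) (4 * (2 * X + 2 + sF) + 12)
    (fun w => (genRound_fst_growth F c k w).1) (fun w => by
      refine (genRound_fst_growth F c k w).2.trans (Nat.add_le_add_left ?_ _)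
      simp only [eval_add, eval_mul, eval_ofNat, eval_X]
      have h1 : (F.descFn (fstP (fstP w))).length ≤ sF.eval (boolUnpair w).1.length :=
        (hsF _).trans (poly_eval_mono sF (length_fstP_le (fstP w)))
      have h2 : (fstP (fstP w)).length ≤ (boolUnpair w).1.length := length_fstP_le (fstP w)
      omega) X
  exact comp_mem_FP sndP_mem_FP (comp_mem_FP sndP_mem_FP (comp_mem_FP hit
    (pairFn_mem_FP (PolyTimeComputable.id _) (pairFn_mem_FP sndP_mem_FP (const_mem_FP [])))))

/-- **The generator is in `FP`.** [cite: AaronsonAmbainis2014, proof of Thm. 23 (p. 14: "poly(n) computation steps")] -/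
theorem genQ_mem_FP : genQ F c k ∈ FP := by
  have hst : mkWFn F ∘ pairFn fstP (genIter F c k) ∈ FP :=
    comp_mem_FP (mkWFn_mem_FP hU) (pairFn_mem_FP fstP_mem_FP (genIter_mem_FP c k hU hP))
  exact iteFn_mem_FP (comp_mem_FP (indic_mem_FP hP (live_mem_CH c k hU)) hst)
    (comp_mem_FP strOf_rev_mem_FP.1 (comp_mem_FP (pickBitsFn_mem_FP c k hU hP) hst)) (const_mem_FP [])

/-- **The evaluator is in `P`.** [cite: AaronsonAmbainis2014, proof of Thm. 23 (p. 14)] -/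
theorem evalD_mem_P : evalD F c k ∈ Classes.P :=
  preimage_mem_P (mem_P_of_mem_CH hP (outL_mem_CH hU))
    (comp_mem_FP (mkWFn_mem_FP hU) (pairFn_mem_FP fstP_mem_FP (genIter_mem_FP c k hU hP)))

end Growth

/-! ## Part 4 — the generator replays the simulation walk -/

/-! ### The parameters of the tree -/

section Params

variable (F : QCircuitFamily cliffordT) (x : List Bool) (c k : ℕ)

/-- The variance threshold `θ = ε²δ/2` of `simTreeOn` (`ε = 1/10`, `δ = thm23Delta x`). [cite: AaronsonAmbainis2014, proof of Thm. 23 (p. 14)] -/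
def theta0 : ℝ := (1 / 10) ^ 2 * thm23Delta x / 2

/-- The influence threshold `w = 2^{-k} (θ/d)^c` of `simTreeOn`. [cite: AaronsonAmbainis2014, proof of Thm. 23 (p. 14)] -/
def wthr0 : ℝ := (2 : ℝ)⁻¹ ^ k * (theta0 x / thm23Degree F x) ^ c

/-- The budget `⌈8d/(wδ)⌉` of `simTreeOn`. [cite: AaronsonAmbainis2014, proof of Thm. 23 (p. 14)] -/
def budget0 : ℕ := Nat.ceil (8 * (thm23Degree F x : ℝ) / (wthr0 F x c k * thm23Delta x))

/-- `simTreeOn` is the tree of these parameters on the acceptance polynomial. [folklore] -/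
theorem simTreeOn_eq : simTreeOn c ((2 : ℝ)⁻¹ ^ k) F x = simTree (theta0 x) (wthr0 F x c k) (budget0 F x c k) (acceptPoly F x) := rfl

/-- The budget as a natural number: `16 d n³ 2^k (400 n³ d)^c`. [folklore] -/
def budgetN : ℕ := 16 * thm23Degree F x * x.length ^ 3 * 2 ^ k * (400 * x.length ^ 3 * thm23Degree F x) ^ c

variable {x}

/-- **`θ = 1/(400 n³)`.** [folklore] -/
theorem theta0_eq (hn : 1 ≤ x.length) : theta0 x = ((1 : ℕ) : ℝ) / ((400 * x.length ^ 3 : ℕ) : ℝ) := by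
  unfold theta0 thm23Delta
  have : (0 : ℝ) < x.length := by exact_mod_cast hn
  push_cast
  field_simp
  ring

/-- **`w = 1/(2^k (400 n³ d)^c)`.** [folklore] -/
theorem wthr0_eq (hn : 1 ≤ x.length) :
    wthr0 F x c k = ((1 : ℕ) : ℝ) / ((2 ^ k * (400 * x.length ^ 3 * thm23Degree F x) ^ c : ℕ) : ℝ) := by
  unfold wthr0
  rw [theta0_eq hn]
  have hd : (0 : ℝ) < thm23Degree F x := by unfold thm23Degree; positivity
  have : (0 : ℝ) < x.length := by exact_mod_cast hn
  push_cast
  rw [div_div, inv_pow, ← one_div, div_pow, one_pow, div_mul_div_comm, one_mul]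

/-- `w > 0`. [folklore] -/
theorem wthr0_pos (hn : 1 ≤ x.length) : 0 < wthr0 F x c k := by
  rw [wthr0_eq F c k hn]; unfold thm23Degree; positivity

/-- **`⌈8d/(wδ)⌉ = 16 d n³ 2^k (400 n³ d)^c`.** [folklore] -/
theorem budget0_eq (hn : 1 ≤ x.length) : budget0 F x c k = budgetN F x c k := by
  unfold budget0 budgetN
  rw [wthr0_eq F c k hn]
  unfold thm23Delta
  have : (0 : ℝ) < x.length := by exact_mod_cast hn
  have hd : (0 : ℝ) < thm23Degree F x := by unfold thm23Degree; positivity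
  have key : 8 * (thm23Degree F x : ℝ) / (((1 : ℕ) : ℝ) / ((2 ^ k * (400 * x.length ^ 3 * thm23Degree F x) ^ c : ℕ) : ℝ) *
      (1 / (2 * (x.length : ℝ) ^ 3))) = ((16 * thm23Degree F x * x.length ^ 3 * 2 ^ k * (400 * x.length ^ 3 * thm23Degree F x) ^ c : ℕ) : ℝ) := by
    push_cast
    field_simp
    ring
  rw [key, Nat.ceil_natCast]

end Params

/-! ### The replay state and the predicates on it -/

section State

variable (F : QCircuitFamily cliffordT) (x : List Bool) (c k : ℕ)

/-- The restrictions, coded NEWEST-first (the replay conses new items). [folklore] -/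
def rhoRev (ρ : List (Fin (numOracleBits F x) × Bool)) : List Bool :=
  encList (ρ.map fun e => boolPair (encodeNat (e.1 : ℕ)) [e.2]).reverse

variable {x} (hn : 1 ≤ x.length)
include hn

/-- `M ≥ 1` for a nonempty input. [folklore] -/
theorem numOracleBits_pos : 0 < numOracleBits F x := by
  rw [numOracleBits_eq]
  have : 1 ≤ oracleWidth F x := le_add_right hn
  have : 2 ^ 1 ≤ 2 ^ oracleWidth F x := Nat.pow_le_pow_right (by norm_num) this
  omega

/-- The default flip position `0`. [folklore] -/
def i0 : Fin (numOracleBits F x) := ⟨0, numOracleBits_pos F hn⟩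

omit hn in
/-- **Reversing the coded restrictions gives `encRho ρ`.** [folklore] -/
theorem revItemsFn_rhoRev (ρ : List (Fin (numOracleBits F x) × Bool)) : revItemsFn (rhoRev F x ρ) = encRho ρ := by
  unfold revItemsFn rhoRev encRho
  simp only [Function.comp_apply, pairFn_apply, lenBinF_apply]
  rw [takeRevLF_apply _ le_rfl, List.take_of_length_le, List.reverse_reverse]
  exact (two_mul_length_le_length_encList _).trans' (by omega)

/-- **The node word of a replay state is the coded node with flip position `0`.** [folklore] -/
theorem mkWFn_state (ρ : List (Fin (numOracleBits F x) × Bool)) :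
    mkWFn F (boolPair x (rhoRev F x ρ)) = encW F x ρ (i0 F hn) := by
  unfold mkWFn encW i0
  simp only [pairFn_apply, Function.comp_apply, fstP_boolPair, sndP_boolPair, revItemsFn_rhoRev]
  rfl

omit hn in
/-- The accessors on a coded node; `wAt` resets the flip position. [folklore] -/
theorem wAcc_encW (ρ : List (Fin (numOracleBits F x) × Bool)) (j : Fin (numOracleBits F x)) :
    xWf (encW F x ρ j) = x ∧ dWf (encW F x ρ j) = F.descFn x ∧ rhoWf (encW F x ρ j) = encRho ρ ∧
      ∀ i : Fin (numOracleBits F x), wAt (encW F x ρ j) i = encW F x ρ i := by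
  refine ⟨?_, ?_, ?_, fun i => ?_⟩ <;> simp [xWf, dWf, rhoWf, wAt, encW]

omit hn in
/-- **`lenRho` on a coded node is `|ρ|`.** [folklore] -/
theorem lenRho_encW (ρ : List (Fin (numOracleBits F x) × Bool)) (j : Fin (numOracleBits F x)) : lenRho (encW F x ρ j) = ρ.length := by
  obtain ⟨-, -, hρ, -⟩ := wAcc_encW F ρ j
  unfold lenRho
  rw [hρ, eval_X]
  have hlen : ρ.length ≤ (encRho ρ).length := length_le_length_encRho ρ
  have hW : (encRho ρ).length ≤ (encW F x ρ j).length := by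
    unfold encW; simp only [length_boolPair]; omega
  simp_rw [rLive_encRho_iff]
  rw [show ((range (2 ^ (encW F x ρ j).length)).filter fun m => m < (encRho ρ).length ∧ m < ρ.length) = range ρ.length by
    ext m; simp only [Finset.mem_filter, Finset.mem_range]
    constructor
    · rintro ⟨-, -, h⟩; exact h
    · intro h; exact ⟨h.trans_le ((hlen.trans hW).trans Nat.lt_two_pow_self.le), h.trans_le hlen, h⟩]
  exact Finset.card_range _

omit hn in
/-- **The width and `M` on a coded node.** [folklore] -/
theorem bigM_encW (ρ : List (Fin (numOracleBits F x) × Bool)) (j : Fin (numOracleBits F x)) :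
    widthW (encW F x ρ j) = oracleWidth F x ∧ bigM (encW F x ρ j) = numOracleBits F x := by
  obtain ⟨hx, hd, -, -⟩ := wAcc_encW F ρ j
  have hw : widthW (encW F x ρ j) = oracleWidth F x := by
    unfold widthW; rw [hx, hd, descFn_eq]; simp [ones, oracleWidth]
  exact ⟨hw, by unfold bigM; rw [hw, numOracleBits_eq]⟩

/-- **`budgetD` on a coded node is the budget of the tree.** [folklore] -/
theorem budgetD_encW (ρ : List (Fin (numOracleBits F x) × Bool)) (j : Fin (numOracleBits F x)) :
    budgetD F c k (encW F x ρ j) = budget0 F x c k := by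
  obtain ⟨-, -, hoq, hnn⟩ := counts_encW F x ρ j
  rw [budget0_eq F c k hn]
  unfold budgetD budgetN thm23Degree
  rw [hoq, hnn]

/-- **`Halt` on the replay node** iff the walk's live condition fails. [cite: AaronsonAmbainis2014, Thm. 21 (halting rule)] -/
theorem halt_iff (ρ : List (Fin (numOracleBits F x) × Bool)) :
    Halt F c k (encW F x ρ (i0 F hn)) ↔ ¬ (ρ.length < budget0 F x c k ∧ ¬ boolVariance (nodePoly (acceptPoly F x) ρ) ≤ theta0 x) := by
  unfold Halt
  rw [budgetD_encW F c k hn, lenRho_encW, mem_varL_iff F x ρ _ hn, ← theta0_eq hn]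
  constructor
  · rintro (h | h) ⟨h1, h2⟩
    · exact absurd h (not_le.2 h1)
    · exact h2 h
  · intro h
    by_cases hv : boolVariance (nodePoly (acceptPoly F x) ρ) ≤ theta0 x
    · exact Or.inr hv
    · left; by_contra hlt; exact h ⟨not_le.1 hlt, hv⟩

/-- **`InfAt` on the replay node** iff the variable is influential enough. [cite: AaronsonAmbainis2014, proof of Thm. 23 (p. 14)] -/
theorem infAt_iff (ρ : List (Fin (numOracleBits F x) × Bool)) (i : Fin (numOracleBits F x)) :
    InfAt F c k (encW F x ρ (i0 F hn)) i ↔ wthr0 F x c k ≤ influence i (nodePoly (acceptPoly F x) ρ) := by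
  unfold InfAt
  rw [(wAcc_encW F ρ _).2.2.2 i, mem_infL_iff F x ρ i c k hn, ← wthr0_eq F c k hn]

/-- **`IsPick` on the replay node** iff `pickVar` picks the variable. [cite: AaronsonAmbainis2014, proof of Thm. 23 (p. 14: "finding an i")] -/
theorem isPick_iff (ρ : List (Fin (numOracleBits F x) × Bool)) (i : Fin (numOracleBits F x)) :
    IsPick F c k (encW F x ρ (i0 F hn)) i ↔ pickVar (wthr0 F x c k) (nodePoly (acceptPoly F x) ρ) = some i := by
  unfold IsPick
  rw [pickVar_eq_some_iff, infAt_iff F c k hn]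
  constructor
  · rintro ⟨h1, h2⟩
    exact ⟨h1, fun j hj => by rw [← infAt_iff F c k hn]; exact h2 j hj⟩
  · rintro ⟨h1, h2⟩
    refine ⟨h1, fun i' hi' h => ?_⟩
    have hi'M : i' < numOracleBits F x := hi'.trans i.2
    have := h2 ⟨i', hi'M⟩ hi'
    rw [← infAt_iff F c k hn] at this
    exact this h

/-- **`Live` on the replay node iff the walk queries a variable** (`nextVar ≠ none`). [cite: AaronsonAmbainis2014, Thm. 21] -/
theorem live_iff (ρ : List (Fin (numOracleBits F x) × Bool)) :
    Live F c k (encW F x ρ (i0 F hn)) ↔ nextVar (theta0 x) (wthr0 F x c k) (budget0 F x c k) (acceptPoly F x) ρ ≠ none := by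
  unfold Live nextVar
  rw [halt_iff F c k hn, (bigM_encW F ρ _).2, not_not]
  constructor
  · rintro ⟨hlive, i, hi, hinf⟩
    rw [if_pos hlive]
    exact pickVar_ne_none ⟨⟨i, hi⟩, (infAt_iff F c k hn ρ ⟨i, hi⟩).1 hinf⟩
  · intro h
    by_cases hlive : ρ.length < budget0 F x c k ∧ ¬ boolVariance (nodePoly (acceptPoly F x) ρ) ≤ theta0 x
    · rw [if_pos hlive] at h
      refine ⟨hlive, ?_⟩
      by_contra hne
      apply h
      rw [pickVar_eq_none_iff]
      intro i hinf
      exact hne ⟨i, i.2, (infAt_iff F c k hn ρ i).2 hinf⟩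
    · rw [if_neg hlive] at h; exact absurd rfl h

omit hn in
/-- If the walk queries `i`, the node is live and `pickVar` picks `i`. [folklore] -/
theorem pickVar_of_nextVar {ρ : List (Fin (numOracleBits F x) × Bool)} {i : Fin (numOracleBits F x)}
    (h : nextVar (theta0 x) (wthr0 F x c k) (budget0 F x c k) (acceptPoly F x) ρ = some i) :
    pickVar (wthr0 F x c k) (nodePoly (acceptPoly F x) ρ) = some i := by
  unfold nextVar at h; split_ifs at h; exact h

/-- **The bits of the replay: the bits of the queried variable.** [folklore] -/
theorem pbit_eq {ρ : List (Fin (numOracleBits F x) × Bool)} {i : Fin (numOracleBits F x)}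
    (h : nextVar (theta0 x) (wthr0 F x c k) (budget0 F x c k) (acceptPoly F x) ρ = some i) (j : ℕ) :
    pbit F c k (encW F x ρ (i0 F hn)) j = (i : ℕ).testBit j := by
  have hp := pickVar_of_nextVar F c k h
  unfold pbit
  rw [(bigM_encW F ρ _).2]
  have key : (∃ i' < numOracleBits F x, IsPick F c k (encW F x ρ (i0 F hn)) i' ∧ i'.testBit j = true) ↔ (i : ℕ).testBit j = true := by
    constructor
    · rintro ⟨i', hi', hpick, hbit⟩
      rw [isPick_iff F c k hn ρ ⟨i', hi'⟩, hp, Option.some.injEq] at hpick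
      rw [hpick]; exact hbit
    · intro hbit
      exact ⟨i, i.2, (isPick_iff F c k hn ρ i).2 hp, hbit⟩
  rw [Bool.eq_iff_iff, decide_eq_true_iff, key]

end State

/-! ### The picked index and its query string -/

section Pick

variable (F : QCircuitFamily cliffordT) {x : List Bool} (c k : ℕ) (hn : 1 ≤ x.length)
include hn

omit hn in
/-- The indicator of a set-builder language. [folklore] -/
theorem indic_setOf (P : List Bool → Prop) (w : List Bool) : indic {v | P v} w = [decide (P w)] := indic_apply _ _

/-- The bit loop is long enough: `width + 1 ≤ |⟨x, d⟩|`. [folklore] -/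
theorem width_lt_yard : oracleWidth F x < (boolPair x (F.descFn x)).length := by
  rw [length_boolPair, descFn_eq]
  simp only [length_boolPair, ones, List.length_replicate, oracleWidth]
  omega

/-- **The bit loop computes the queried variable**: `val (pickBitsFn W) = i` when the walk queries `i`. [cite: AaronsonAmbainis2014, proof of Thm. 23 (p. 14)] -/
theorem bitsToNat_pickBitsFn {ρ : List (Fin (numOracleBits F x) × Bool)} {i : Fin (numOracleBits F x)}
    (h : nextVar (theta0 x) (wthr0 F x c k) (budget0 F x c k) (acceptPoly F x) ρ = some i) :
    bitsToNat (pickBitsFn F c k (encW F x ρ (i0 F hn))) = (i : ℕ) := by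
  obtain ⟨hx, hd, -, -⟩ := wAcc_encW F ρ (i0 F hn)
  rw [pickBitsFn_apply, hx, hd]
  apply Nat.eq_of_testBit_eq
  intro j
  rw [Com.testBit_bitsToNat, List.getD_eq_getElem?_getD, List.getElem?_map]
  by_cases hj : j < (boolPair x (F.descFn x)).length
  · rw [List.getElem?_range hj]; simp [pbit_eq F c k hn h]
  · rw [List.getElem?_eq_none (by simpa using not_lt.1 hj)]
    simp only [Option.map_none, Option.getD_none]
    symm
    apply Nat.testBit_lt_two_pow
    have hiM := i.2
    have hM := numOracleBits_eq F x
    have hw := width_lt_yard F hn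
    calc (i : ℕ) < 2 ^ oracleWidth F x := by have := Nat.one_le_two_pow (n := oracleWidth F x); omega
      _ ≤ 2 ^ j := Nat.pow_le_pow_right (by norm_num) (by omega)

omit hn in
/-- **The query string of a numeral**: `strOfFn u ++ [1] = bin (val u + 1)`, so `strNum (strOfFn u) = val u`. [folklore] -/
theorem strOfFn_spec (u : List Bool) : strOfFn u ++ [true] = encodeNat (bitsToNat u + 1) ∧ strNum (strOfFn u) = bitsToNat u := by
  have ha : (addFn ∘ pairFn (fun u => u) (fun _ => [true])) u = encodeNat (bitsToNat u + 1) := by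
    simp [pairFn_apply]
  obtain ⟨v, hv⟩ : ∃ v, encodeNat (bitsToNat u + 1) = v ++ [true] := by
    rcases encodeNat_canonical (bitsToNat u + 1) with h0 | h
    · have := congrArg bitsToNat h0; simp at this
    · exact h
  have hs : strOfFn u = v := by
    unfold strOfFn
    simp only [Function.comp_apply, pairFn_apply, takeFn_boolPair]
    rw [show addFn (boolPair u [true]) = encodeNat (bitsToNat u + 1) by simp, hv]
    simp
  refine ⟨by rw [hs, hv], ?_⟩
  unfold strNum; rw [hs, ← hv, bitsToNat_encodeNat]; rfl

/-- **The query string of the queried variable is the variable's string.** [folklore] -/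
theorem strOfFn_pickBitsFn {ρ : List (Fin (numOracleBits F x) × Bool)} {i : Fin (numOracleBits F x)}
    (h : nextVar (theta0 x) (wthr0 F x c k) (budget0 F x c k) (acceptPoly F x) ρ = some i) :
    strOfFn (pickBitsFn F c k (encW F x ρ (i0 F hn))) = ((bitEquiv F x).symm i).1 := by
  set s := strOfFn (pickBitsFn F c k (encW F x ρ (i0 F hn))) with hs
  have hnum : strNum s = i := by rw [hs, (strOfFn_spec _).2, bitsToNat_pickBitsFn F c k hn h]
  have hlen : s.length < oracleWidth F x := by
    have h1 := le_strNum s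
    have hiM := i.2
    have hM := numOracleBits_eq F x
    by_contra hle
    have : 2 ^ oracleWidth F x ≤ 2 ^ s.length := Nat.pow_le_pow_right (by norm_num) (not_lt.1 hle)
    omega
  have := (bitEquiv_symm_eq_iff F x i ⟨s, mem_shortStrings.2 hlen⟩).2 hnum
  rw [this]

end Pick

/-! ### The rounds replay the walk -/

section Rounds

variable (F : QCircuitFamily cliffordT) {x : List Bool} (c k : ℕ) (hn : 1 ≤ x.length)
include hn

omit hn in
/-- Consing an item onto the newest-first code. [folklore] -/
theorem rhoRev_append (ρ : List (Fin (numOracleBits F x) × Bool)) (i : Fin (numOracleBits F x)) (b : Bool) :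
    rhoRev F x (ρ ++ [(i, b)]) = boolPair (boolPair (encodeNat (i : ℕ)) [b]) (rhoRev F x ρ) := by
  unfold rhoRev; simp [encList_cons]

/-- **One generator round is one step of the walk** (and consumes one answer bit). [cite: AaronsonAmbainis2014, Thm. 21 (one query)] -/
theorem genRound_state (bs bs' : List Bool) (ρ : List (Fin (numOracleBits F x) × Bool)) :
    genRound F c k (boolPair (boolPair x bs) (boolPair bs' (rhoRev F x ρ))) =
      boolPair (boolPair x bs) (boolPair bs'.tail (rhoRev F x
        (if bs' = [] then ρ else stepR (theta0 x) (wthr0 F x c k) (budget0 F x c k) (acceptPoly F x) ρ (headBit bs')))) := by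
  have hW : (mkWFn F ∘ pairFn (fstP ∘ fstP) (sndP ∘ sndP)) (boolPair (boolPair x bs) (boolPair bs' (rhoRev F x ρ))) = encW F x ρ (i0 F hn) := by
    simp only [Function.comp_apply, pairFn_apply, fstP_boolPair, sndP_boolPair]; exact mkWFn_state F hn ρ
  have hcond : liveRoundT F c k (boolPair (boolPair x bs) (boolPair bs' (rhoRev F x ρ))) =
      [decide (bs' ≠ []) && decide (Live F c k (encW F x ρ (i0 F hn)))] := by
    unfold liveRoundT
    rw [andFn_apply (notFn_apply (nilT_apply _ _)) (by rw [Function.comp_apply, hW, indic_setOf])]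
    simp only [Function.comp_apply, fstP_boolPair, sndP_boolPair]
    cases bs' <;> simp
  have hcons : consItemFn F c k (boolPair (boolPair x bs) (boolPair bs' (rhoRev F x ρ))) =
      boolPair (boolPair (norm (pickBitsFn F c k (encW F x ρ (i0 F hn)))) (take1Fn bs')) (rhoRev F x ρ) := by
    unfold consItemFn
    simp only [pairFn_apply, Function.comp_apply, fstP_boolPair, sndP_boolPair, mkWFn_state F hn]
  unfold genRound
  rw [pairFn_apply, pairFn_apply, iteFn_apply hcond]
  simp only [Function.comp_apply, fstP_boolPair, sndP_boolPair]
  by_cases hnil : bs' = []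
  · subst hnil; simp
  · rw [if_neg hnil]
    simp only [hnil, ne_eq, not_false_eq_true, decide_true, Bool.true_and]
    by_cases hlive : Live F c k (encW F x ρ (i0 F hn))
    · rw [decide_eq_true hlive, if_pos rfl, hcons]
      obtain ⟨i, hi⟩ := Option.ne_none_iff_exists'.1 ((live_iff F c k hn ρ).1 hlive)
      rw [stepR_of_some hi, rhoRev_append, norm_eq_encodeNat, bitsToNat_pickBitsFn F c k hn hi]
      obtain ⟨b, l, rfl⟩ := List.exists_cons_of_ne_nil hnil
      simp [take1Fn]
    · rw [decide_eq_false hlive]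
      simp only [Bool.false_eq_true, ↓reduceIte]
      have hnone : nextVar (theta0 x) (wthr0 F x c k) (budget0 F x c k) (acceptPoly F x) ρ = none := by
        by_contra hne; exact hlive ((live_iff F c k hn ρ).2 hne)
      rw [stepR_of_none hnone]

/-- **`r` rounds replay the walk on the first `r` answers.** [folklore] -/
theorem genRound_iterate (bs : List Bool) : ∀ r : ℕ,
    (genRound F c k)^[r] (boolPair (boolPair x bs) (boolPair bs (rhoRev F x []))) =
      boolPair (boolPair x bs) (boolPair (bs.drop r)
        (rhoRev F x (walkR (theta0 x) (wthr0 F x c k) (budget0 F x c k) (acceptPoly F x) (bs.take r))))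
  | 0 => by simp
  | r + 1 => by
    rw [Function.iterate_succ_apply', genRound_iterate bs r, genRound_state F c k hn, List.tail_drop]
    congr 3
    by_cases hr : r < bs.length
    · rw [if_neg (by rw [List.drop_eq_nil_iff]; omega), List.take_add_one, List.getElem?_eq_getElem hr]
      simp only [Option.toList_some, walkR_append_singleton]
      congr 1
      rw [headBit_eq_getD, List.getD_eq_getElem?_getD, List.getElem?_drop, Nat.add_zero, List.getElem?_eq_getElem hr]
      rfl
    · rw [if_pos (List.drop_eq_nil_of_le (not_lt.1 hr)), List.take_of_length_le (not_lt.1 hr),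
        List.take_of_length_le (by omega)]

/-- **The replay computes the node of the walk**, newest restriction first. [cite: AaronsonAmbainis2014, Thm. 21] -/
theorem genIter_apply (bs : List Bool) :
    genIter F c k (boolPair x bs) = rhoRev F x (walkR (theta0 x) (wthr0 F x c k) (budget0 F x c k) (acceptPoly F x) bs) := by
  unfold genIter
  simp only [Function.comp_apply, pairFn_apply, sndP_boolPair, boolUnpair_boolPair, eval_X]
  rw [show ([] : List Bool) = rhoRev F x [] from by simp [rhoRev], genRound_iterate F c k hn bs]
  simp only [sndP_boolPair]
  rw [List.take_of_length_le]
  rw [length_boolPair]; omega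

/-- **The query of the generator**: the string of the variable the walk queries next, or `ε` if
it halts. [cite: AaronsonAmbainis2014, proof of Thm. 23 (p. 14)] -/
theorem genQ_apply (bs : List Bool) :
    genQ F c k (boolPair x bs) =
      match nextVar (theta0 x) (wthr0 F x c k) (budget0 F x c k) (acceptPoly F x)
          (walkR (theta0 x) (wthr0 F x c k) (budget0 F x c k) (acceptPoly F x) bs) with
      | some i => ((bitEquiv F x).symm i).1
      | none => [] := by
  set ρ := walkR (theta0 x) (wthr0 F x c k) (budget0 F x c k) (acceptPoly F x) bs with hρ
  have hW : (mkWFn F ∘ pairFn fstP (genIter F c k)) (boolPair x bs) = encW F x ρ (i0 F hn) := by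
    simp only [Function.comp_apply, pairFn_apply, fstP_boolPair, genIter_apply F c k hn]; exact mkWFn_state F hn ρ
  unfold genQ
  rw [iteFn_apply (b := decide (Live F c k (encW F x ρ (i0 F hn)))) (by rw [Function.comp_apply, hW, indic_setOf])]
  cases hnv : nextVar (theta0 x) (wthr0 F x c k) (budget0 F x c k) (acceptPoly F x) ρ with
  | none =>
    have : ¬ Live F c k (encW F x ρ (i0 F hn)) := fun h => (live_iff F c k hn ρ).1 h hnv
    rw [decide_eq_false this]; rfl
  | some i =>
    have : Live F c k (encW F x ρ (i0 F hn)) := (live_iff F c k hn ρ).2 (by rw [hnv]; simp)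
    rw [decide_eq_true this, if_pos rfl, Function.comp_apply, Function.comp_apply, hW, strOfFn_pickBitsFn F c k hn hnv]

/-- **The verdict of the evaluator**: `[E[p_ρ] ≥ 1/2]` at the node reached by the answers. [cite: AaronsonAmbainis2014, proof of Thm. 23 (p. 14), Cor. 22] -/
theorem mem_evalD_iff (bs : List Bool) :
    boolPair x bs ∈ evalD F c k ↔ (1 : ℝ) / 2 ≤ boolAvg (evalBool (nodePoly (acceptPoly F x)
      (walkR (theta0 x) (wthr0 F x c k) (budget0 F x c k) (acceptPoly F x) bs))) := by
  rw [← mem_outL_iff F x _ (i0 F hn)]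
  change (mkWFn F ∘ pairFn fstP (genIter F c k)) (boolPair x bs) ∈ outL F ↔ _
  simp only [Function.comp_apply, pairFn_apply, fstP_boolPair, genIter_apply F c k hn, mkWFn_state F hn]

end Rounds

/-! ## Part 5 — the machine -/


variable (F : QCircuitFamily cliffordT) (c k : ℕ)

/-- **The round budget** `q₀ = 16·(2s+1)·X³·2^k·(400·X³·(2s+1))^c` for a size bound `s`. [folklore] -/
def roundPoly (s : Polynomial ℕ) : Polynomial ℕ :=
  16 * (2 * s + 1) * X ^ 3 * C (2 ^ k) * (400 * X ^ 3 * (2 * s + 1)) ^ c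

variable {F}

/-- The budget of the tree is at most the round budget. [folklore] -/
theorem budget0_le_roundPoly {s : Polynomial ℕ} (hs : ∀ n, (F.circ n).size ≤ s.eval n) {x : List Bool} (hn : 1 ≤ x.length) :
    budget0 F x c k ≤ (roundPoly c k s).eval x.length := by
  rw [budget0_eq F c k hn]
  unfold budgetN roundPoly
  have hd : thm23Degree F x ≤ 2 * s.eval x.length + 1 := by
    unfold thm23Degree QCircuit.oracleQueries
    have h1 := List.length_filter_le (fun g => ¬ g.IsOracleFree) (F.circ x.length).gates
    have h2 := hs x.length
    unfold QCircuit.size at h2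
    omega
  simp only [eval_mul, eval_pow, eval_add, eval_ofNat, eval_X, eval_C, eval_one]
  gcongr

/-- **The answers of the transcript are the oracle bits the walk asks for.** [folklore] -/
theorem answers_adBits {x : List Bool} (hn : 1 ≤ x.length) (A : Language Bool) (N : ℕ) :
    Answers (theta0 x) (wthr0 F x c k) (budget0 F x c k) (acceptPoly F x) (oracleBits F x A)
      (adBits (genQ F c k) A x N) := by
  intro t ht i hi
  rw [length_adBits] at ht
  have htake : (adBits (genQ F c k) A x N).take t = adBits (genQ F c k) A x t := adBits_take A x ht.le
  rw [htake] at hi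
  have hget : (adBits (genQ F c k) A x N)[t]'(by rw [length_adBits]; exact ht) =
      A.boolIndicator (genQ F c k (boolPair x (adBits (genQ F c k) A x t))) := by
    have h1 : (adBits (genQ F c k) A x N).take (t + 1) = adBits (genQ F c k) A x (t + 1) := adBits_take A x ht
    rw [adBits_succ] at h1
    have h2 := congrArg (fun l : List Bool => l[t]?) h1
    simp only [List.getElem?_take, Nat.lt_succ_self, if_true] at h2
    rw [List.getElem?_append_right (by simp), length_adBits, Nat.sub_self, List.getElem?_cons_zero] at h2
    exact (List.getElem_eq_iff (by rw [length_adBits]; exact ht)).2 h2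
  rw [hget, genQ_apply F c k hn, hi]
  unfold oracleBits
  rw [restrictBool_apply]
  unfold Set.boolIndicator
  dsimp only
  split_ifs with hA
  · exact (decide_eq_true hA).symm
  · exact (decide_eq_false hA).symm

/-- **The machine of the proof of Thm. 23** (polynomial-time half): for `c, k`, under `P = P^{#P}`,
a uniform Clifford+T query family `F` is simulated by a `poly(n)`-time deterministic oracle
machine with `poly(n)` queries of `poly(n)` length whose verdict on `(A, x)` is
`[(simTreeOn c 2^{-k} F x).eval (oracleBits F x A) ≥ 1/2]`. [cite: AaronsonAmbainis2014, Thm. 23 (proof, first half, p. 14)] -/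
theorem thm23_machine (hP : Classes.P = PSharpP) (hU : F.IsUniform) :
    ∃ (C : OracleAlg Bool) (q : Polynomial ℕ), C.IsPolyTime encodingBoolBool ∧
      (∀ (A : Language Bool) (x : List Bool),
        ∀ y ∈ C.queries (Oracle.ofLanguage A) (q.eval x.length) x, y.length ≤ q.eval x.length) ∧
      ∀ (A : Language Bool) (x : List Bool), 1 ≤ x.length →
        C.run (Oracle.ofLanguage A) (q.eval x.length) x =
          some (decide (1 / 2 ≤ (simTreeOn c ((2 : ℝ)⁻¹ ^ k) F x).eval (oracleBits F x A))) := by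
  obtain ⟨s, hs⟩ := QCircuitFamily.IsUniform.isPolySize' hU
  have hQ := genQ_mem_FP c k hU hP
  have hD := evalD_mem_P c k hU hP
  obtain ⟨sQ, hsQ⟩ := exists_poly_length_le_of_mem_FP hQ
  set q₀ := roundPoly c k s with hq₀
  refine ⟨adAlg (genQ F c k) q₀ (evalD F c k), q₀ + 1 + sQ.comp (2 * X + 2 + q₀), isPolyTime_adAlg hQ hD, fun A x y hy => ?_,
    fun A x hn => ?_⟩
  · obtain ⟨i, hi, rfl⟩ := exists_of_mem_queries_adAlg A x hy
    refine (hsQ _).trans ?_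
    simp only [eval_add, eval_one, eval_comp, eval_mul, eval_ofNat, eval_X, length_boolPair, length_adBits]
    have : sQ.eval (2 * x.length + 2 + i) ≤ sQ.eval (2 * x.length + 2 + q₀.eval x.length) := poly_eval_mono sQ (by omega)
    omega
  · rw [run_adAlg A x (by simp only [eval_add, eval_one]; omega)]
    congr 1
    have hmem := mem_adLang_iff (Q := genQ F c k) (q := q₀) (D := evalD F c k) (A := A) (x := x)
    rw [mem_evalD_iff F c k hn] at hmem
    rw [simTreeOn_eq, simTree_output_eq_of_answers (bs := adBits (genQ F c k) A x (q₀.eval x.length))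
      (by rw [length_adBits]; exact budget0_le_roundPoly c k (fun n => (hs n).1) hn) (answers_adBits c k hn A _)]
    unfold Set.boolIndicator
    split_ifs with hx
    · exact (decide_eq_true (hmem.1 hx)).symm
    · exact (decide_eq_false (fun h => hx (hmem.2 h))).symm

end Thm23Machine

open _root_.Computability Polynomial Literature.Computability.Complexity Cryptography in
/-- **[AA14, Thm. 23, proof, first half] — the machine hypothesis `hmach` of
`aaronsonAmbainis2014_thm23_apx_of_dyadicMachines` / `randomOracleMethod_of_dyadicMachines`,
proved** (the conjecture-body hypothesis is not even needed for the running time, only for the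
correctness analysis done in `AaronsonAmbainisThm23Queries.lean`). [cite: AaronsonAmbainis2014, Thm. 23 (proof, first half, p. 14)] -/
theorem thm23_dyadicMachines (c k : ℕ)
    (_hconj : ∀ (N d : ℕ) (p : MvPolynomial (Fin N) ℝ) (ε : ℝ), 1 ≤ d → p.totalDegree ≤ d →
      (∀ y, 0 ≤ evalBool p y ∧ evalBool p y ≤ 1) → 0 < ε → ε ≤ boolVariance p →
        ∃ i : Fin N, (2 : ℝ)⁻¹ ^ k * (ε / d) ^ c ≤ influence i p)
    (hP : Classes.P = PSharpP) (F : QCircuitFamily cliffordT) (hU : F.IsUniform) :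
    ∃ (C : OracleAlg Bool) (q : Polynomial ℕ), C.IsPolyTime encodingBoolBool ∧
      (∀ (A : Language Bool) (x : List Bool),
        ∀ y ∈ C.queries (Oracle.ofLanguage A) (q.eval x.length) x, y.length ≤ q.eval x.length) ∧
      ∀ (A : Language Bool) (x : List Bool), 1 ≤ x.length →
        C.run (Oracle.ofLanguage A) (q.eval x.length) x =
          some (decide (1 / 2 ≤ (simTreeOn c ((2 : ℝ)⁻¹ ^ k) F x).eval (oracleBits F x A))) :=
  Thm23Machine.thm23_machine c k hP hU

end Literature.Computability.QuantumComplexity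

end
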